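import Literature.MathematicalPhysics.QuantumFieldTheory.Balaban1983to89.B1Eq324BenfattoKernelSect5Eq515
import HarnessLib

/-!
# `Balaban1983to89.B1Eq324BenfattoKernelSect5Eq536` — [BenfattoEtAl1978] §5 p. 159, (5.36): (5.13) UNDER THE CONDITIONED MEASURE `P̄ = P̂₀(·|z̄_C)`,
# FOR THE CLASS of [Balaban1985BackgroundPropagators] Sect. E p. 428 — outer measure `P̄^K_{C,z̄}`, inner conditioning on `C ∪ Γ₁`, parts with the
# `C`-sites removed, two-sided with the cut-offs' budget discharged, PROVED (the structural input of the upper bound (4.6) with `C ≠ ∅`)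

statement-level skeleton of published theorems with citation tags; proofs where landed; nothing here is a claim about the
Yang–Mills mass gap

WHY THIS MODULE (cell `pub-ymgap`, seat `dag-n08-d` gen 13, INTENT-56; node N08 [Balaban1985UV3]; the [BenfattoEtAl1978] source chain behind the
(α)-row `h324`; row S7 of `N08-PORT-MAP-STRUCTURAL-SIDE.md`).  Print, p. 159: *"The inequality (4.6) is obtained by simple modifications of (4.7). We
start from (5.13), then assuming |z_Δ| ≦ b(1 + d(Δ, I)), ∀Δ ∈ C: [(5.12)] ≦ ∫P̄(dz_{Γ₁})χ^{Γ₁}_b exp H_{Γ₁} (Π ∫P̄(dz_□|z_{Γ₁})χ^□_b)·(Π ∫P̄(dz_□|z_{Γ₁}) exp Ψ_□χ^□_b)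
(5.36)"* with `P̄ = P̂₀(·|(z̄_Δ)_{Δ∈C})`.  The concrete `…Sect5Eq536` (this seat, gen 9) proved the factorisation IDENTITY under `P̄` by the two-stage
conditioning and the exact Markov property.  `…KernelSect5Eq515` (p609780) is the class edition at `C = ∅`; this file is the class edition at a general
conditioning set `C`: the outer measure is the conditioned class field `P̄^K_{C,z̄}`, the inner one `P̄^K_{C∪Γ₁,ξ}` (two-stage LAW for the class,
`…KernelCondField` §4), the comparison is `…KernelSect5Eq513`'s two-sided (5.13) at the conditioning set `C ∪ Γ₁` (its CORE is stated for ANY `Γ ⊆ Λ`),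
with parts `shrink L m w ∖ C` and the far part of `Λ ∖ (C ∪ Γ₁)` — the `C`-sites inside the boxes and the far region are CONDITIONED, not integrated, and
the box / far observables read them as `Γ`-sites.  The bounded-fluctuation budget is discharged from the cut-offs exactly as at `C = ∅`; the centre row is
asked on the event «`ξ` small on `Γ₁` (threshold `γb`) and on `C` (threshold `b`)», which holds `P̄^K_{C,z̄}`-a.s. once `z̄` is small on `C`.

OBJECTS (all displayed; no definition is made): as in `…KernelSect5Eq515` with the index set `Λ ∖ (C ∪ Γ₁)` in place of `Λ ∖ Γ₁`, parts
`shrink L m w ∖ C`, far part `(Λ ∖ (C ∪ Γ₁)).filter (∀ m ∈ B, · ∉ box L m)`, part kernels `hKb`/`hKout` of the corresponding sub-precisions, part fields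
centred at `u_{C∪Γ₁}(ξ)`; the outer datum `z̄` with `hzbar : z̄ ∈ smallFieldOn ↑C I b`.

WHAT IS PROVED (standard axioms; no `sorry`; no definition).
* §1 `shrink_sdiff_subset_sdiff_union` (`shrink L m w ∖ C ⊆ Λ ∖ (C ∪ Γ₁)`).
* §2 `boxFactor_eq_setIntegral_cond` (on the corridor event a part-field box factor is the set integral `∫_{χ^□_b} e^{W} dN^K_{□∖C,ξ}`),
  `integrable_partIntegrals_cond` (the factorised `ξ`-integrand is `P̄^K_{C,z̄}`-integrable and non-negative).
* §3 ★★★ `integral_boxes_factorise_cond_ge` / `integral_boxes_factorise_cond_le` — THE CLASS TWIN OF `…Sect5Eq536.integral_boxes_factorise_eq_cond`,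
  two-sided, for ANY per-box weights `W_□` reading `□` only, measurable, bounded on the cut-offs' support:
  `e^{−(ρ+T/2)}·∫ χ^{Γ₁}_{γb}(ξ)e^{H_{Γ₁}(ξ)}·[∫χ^{out}_b dN^K_{out,ξ}]·Π_□[∫ χ^{Γ₁(□)}_{γb}χ^□_b e^{W_□} dN^K_{□,ξ}] dP̄^K_{C,z̄}(ξ)
   ≤ ∫ χ^{Γ₁}_{γb}e^{H_{Γ₁}}·χ^{out}_b·Π_□(χ^{Γ₁(□)}_{γb}χ^□_b e^{W_□}) dP̄^K_{C,z̄} ≤ e^{ρ+T/2}·(the same ξ-integral)`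
  (private `inner_two_sided`: at a fixed datum the `C ∪ Γ₁`-values are `ξ`'s and the field vanishes off `Λ` a.s. under `P̄^K_{C∪Γ₁,ξ}`, the prefactor
  comes out, the far cut-off is read inside `Λ`, (A)'s two-sided (5.13) at `Γ := C ∪ Γ₁`; private `integrated_two_sided`: the two-stage tower + the
  integrability of the parametrised part integrals under `P̄^K_{C,z̄}`).
HONEST SCOPE.  Transport and assembly over p609197 / p609780 / p596206 and seat n08-b's matrix estimates; the class, the substitute for (5.13) and the
bounded-fluctuation device are OURS (a reading of [Balaban1985BackgroundPropagators] p. 428 for [Balaban1982Higgs1] p. 616), not print; the upper STEP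
((5.11) upper + per-box UPPER bounds + (5.34) upper) and the per-box bounds under `N^K_{P,ξ}` for `C ≠ ∅` are NOT here; nothing of [Balaban1985UV3] /
[Balaban1985UV2] is asserted; no generalised Basic Lemma is stated; the port is not commissioned and nothing is chained; count-neutral for N08; nothing
about d = 4, the continuum, OS axioms, a mass gap or the Clay problem.
-/

noncomputable section

open MeasureTheory ProbabilityTheory Finset Matrix WithLp
open scoped BigOperators Matrix NNReal ENNReal

namespace Literature.MathematicalPhysics.QuantumFieldTheory.Balaban1983to89.B1Eq324BenfattoKernelSect5Eq536

open Literature.MathematicalPhysics.QuantumFieldTheory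
open Literature.MathematicalPhysics.QuantumFieldTheory.GaussianToolkit
open Literature.MathematicalPhysics.QuantumFieldTheory.Balaban1983to89.B1Eq324BenfattoLemma
open Literature.MathematicalPhysics.QuantumFieldTheory.Balaban1983to89.B1Eq324BenfattoKernelRegression
open Literature.MathematicalPhysics.QuantumFieldTheory.Balaban1983to89.B1Eq324BenfattoKernelOfPrecision
open Literature.MathematicalPhysics.QuantumFieldTheory.Balaban1983to89.B1Eq324BenfattoKernelCondField
open Literature.MathematicalPhysics.QuantumFieldTheory.Balaban1983to89.B1Eq324BenfattoKernelSect5Eq513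
open Literature.MathematicalPhysics.QuantumFieldTheory.Balaban1983to89.B1Eq324BenfattoKernelSect5Eq515
open Literature.MathematicalPhysics.QuantumFieldTheory.Balaban1983to89.B1Eq324BenfattoClassAppendixC (posDef_of_coercive)
open Literature.MathematicalPhysics.QuantumFieldTheory.Balaban1983to89.B1Eq324BenfattoAppendixA (distToRegion_nonneg)
open Literature.MathematicalPhysics.QuantumFieldTheory.Balaban1983to89.B1Eq324BenfattoSect5Boxes
open Literature.MathematicalPhysics.QuantumFieldTheory.Balaban1983to89.B1Eq324BenfattoSect5Eq511 (s1Const)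
open Literature.MathematicalPhysics.QuantumFieldTheory.Balaban1983to89.B1Eq324BenfattoSect5Eq515

variable {d : ℕ}

/-! ## §1  The parts with the conditioned sites removed -/

section Parts

variable {Λ : Finset (B1Eq324BenfattoLemma.Site d)} {L w : ℕ} {B C : Finset (B1Eq324BenfattoLemma.Site d)}

/-- `(□′∪Γ₂(□_m)) ∖ C ⊆ Λ ∖ (C ∪ Γ₁)` for `m ∈ B` when the boxes of `B` lie in `Λ` (`L ≥ 1`). [cite: BenfattoEtAl1978, (5.7)–(5.8) p.154–155, (5.36) p.159] -/
theorem shrink_sdiff_subset_sdiff_union (hL : 0 < L) (hBΛ : ∀ m ∈ B, box L m ⊆ Λ) {m : B1Eq324BenfattoLemma.Site d} (hm : m ∈ B) :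
    shrink L m w \ C ⊆ Λ \ (C ∪ corridors L w B) := fun x hx => by
  have hx' := Finset.mem_sdiff.mp hx
  have h := shrink_subset_sdiff_corridors (w := w) hL hBΛ hm hx'.1
  refine Finset.mem_sdiff.mpr ⟨(Finset.mem_sdiff.mp h).1, ?_⟩
  rw [Finset.mem_union, not_or]
  exact ⟨hx'.2, (Finset.mem_sdiff.mp h).2⟩

end Parts


/-! ## §2  Under the class fields: box factors as set integrals; integrability of the factorised `ξ`-integrand under `P̄^K_{C,z̄}` -/

section Light

variable {Λ : Finset (B1Eq324BenfattoLemma.Site d)} {A : Matrix Λ Λ ℝ}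
  {K : B1Eq324BenfattoLemma.Site d → B1Eq324BenfattoLemma.Site d → ℝ}
  (hK : ∀ x y, K x y = if h : x ∈ Λ ∧ y ∈ Λ then (A⁻¹ : Matrix Λ Λ ℝ) ⟨x, h.1⟩ ⟨y, h.2⟩ else 0)
  {s D : ℕ} {κ : ℝ} {a : Coef d} {J I : Finset (B1Eq324BenfattoLemma.Site d)} {L w : ℕ} {B C : Finset (B1Eq324BenfattoLemma.Site d)} {γ b Ac : ℝ}

include hK

/-- **On the corridor event a part-field box factor (conditioned setting) is a set integral**: for `□_m ∈ B`, `ξ` with `χ^{Γ₁}_{γb}(ξ) = 1` and any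
weight `W`, `∫ χ^{Γ₁(□)}_{γb}χ^□_b e^{W} dN^K_{□∖C,ξ} = ∫_{χ^□_b} e^{W} dN^K_{□∖C,ξ}` (centre `u_{C∪Γ₁}(ξ)`; the `Γ₁`-values are `ξ`'s a.s. by file (A)
`partField_ae_eqOn` at `Γ := C ∪ Γ₁`). The class twin of `…Sect5Eq536.boxFactor_eq_setIntegral_cond`. [cite: BenfattoEtAl1978, (5.36) p.159 (class form)] -/
theorem boxFactor_eq_setIntegral_cond (hA : A.PosDef) (hSΛ : C ∪ corridors L w B ⊆ Λ) (hBΛ : ∀ m ∈ B, box L m ⊆ Λ) (hL : 0 < L)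
    {Kb : B1Eq324BenfattoLemma.Site d → B1Eq324BenfattoLemma.Site d → B1Eq324BenfattoLemma.Site d → ℝ}
    (hKb : ∀ m (hm : m ∈ B) x y, Kb m x y = if h : x ∈ shrink L m w \ C ∧ y ∈ shrink L m w \ C then
      ((A.submatrix (fun j : ↥(shrink L m w \ C) => (⟨j, hBΛ m hm (shrink_subset_box L m w (Finset.mem_sdiff.mp j.2).1)⟩ : Λ))
        (fun j : ↥(shrink L m w \ C) => (⟨j, hBΛ m hm (shrink_subset_box L m w (Finset.mem_sdiff.mp j.2).1)⟩ : Λ)))⁻¹ :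
          Matrix ↥(shrink L m w \ C) ↥(shrink L m w \ C) ℝ) ⟨x, h.1⟩ ⟨y, h.2⟩ else 0)
    {m : B1Eq324BenfattoLemma.Site d} (hm : m ∈ B) (W : (B1Eq324BenfattoLemma.Site d → ℝ) → ℝ) {ξ : B1Eq324BenfattoLemma.Site d → ℝ}
    (hξ : ξ ∈ smallFieldOn (corridors L w B : Set (B1Eq324BenfattoLemma.Site d)) I (γ * b)) :
    ∫ z, (smallFieldOn (frame1 L w m : Set (B1Eq324BenfattoLemma.Site d)) I (γ * b)).indicator (fun _ => (1 : ℝ)) z *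
              (smallFieldOn (shrink L m w : Set (B1Eq324BenfattoLemma.Site d)) I b).indicator (fun _ => (1 : ℝ)) z * Real.exp (W z) ∂((gaussianFieldOfKernel (Kb m)).map
              fun (ζ : B1Eq324BenfattoLemma.Site d → ℝ) (x : B1Eq324BenfattoLemma.Site d) => condMean K (C ∪ corridors L w B) ξ x + ζ x)
      = ∫ z in smallFieldOn (shrink L m w : Set (B1Eq324BenfattoLemma.Site d)) I b, Real.exp (W z) ∂((gaussianFieldOfKernel (Kb m)).map
              fun (ζ : B1Eq324BenfattoLemma.Site d → ℝ) (x : B1Eq324BenfattoLemma.Site d) => condMean K (C ∪ corridors L w B) ξ x + ζ x) := by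
  have hsub : (frame1 L w m : Set (B1Eq324BenfattoLemma.Site d)) ⊆ (corridors L w B : Set (B1Eq324BenfattoLemma.Site d)) :=
    Finset.coe_subset.mpr (frame1_subset_corridors L w hm)
  have hξ1 : ξ ∈ smallFieldOn (frame1 L w m : Set (B1Eq324BenfattoLemma.Site d)) I (γ * b) := smallFieldOn_mono hsub I (γ * b) hξ
  rw [← integral_indicator (measurableSet_smallFieldOn _ I b)]
  refine integral_congr_ae ?_
  filter_upwards [partField_ae_eqOn hK hA hSΛ (shrink_sdiff_subset_sdiff_union hL hBΛ hm) (hKb m hm) ξ] with z hz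
  have hz1 : z ∈ smallFieldOn (frame1 L w m : Set (B1Eq324BenfattoLemma.Site d)) I (γ * b) := by
    intro x hx
    rw [hz x (Finset.mem_union_right _ (Finset.mem_coe.mp (hsub hx)))]
    exact hξ1 x hx
  rw [Set.indicator_of_mem hz1, one_mul]
  by_cases hzS : z ∈ smallFieldOn (shrink L m w : Set (B1Eq324BenfattoLemma.Site d)) I b
  · rw [Set.indicator_of_mem hzS, Set.indicator_of_mem hzS, one_mul]
  · rw [Set.indicator_of_notMem hzS, Set.indicator_of_notMem hzS, zero_mul]

/-- **THE FACTORISED `ξ`-INTEGRAND WITH PART FIELDS IS `P̄^K_{C,z̄}`-INTEGRABLE AND NON-NEGATIVE**: for per-box weights `W_□` measurable and bounded on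
the cut-offs' support, `ξ ↦ χ^{Γ₁}_{γb}(ξ)e^{H_{Γ₁}(ξ)}·[∫χ^{out}_b dN^K_{out,ξ}]·Π_□[∫ χ^{Γ₁(□)}_{γb}χ^□_b e^{W_□} dN^K_{□∖C,ξ}]` is measurable (file (A)'s
`stronglyMeasurable_integral_shift`), bounded by `e^{s₁A_cb^D|Γ₁|}·Π_□e^{K_W}`, hence integrable against the probability measure `P̄^K_{C,z̄}` (`C ⊆ Λ`).
[cite: BenfattoEtAl1978, §5 (5.36) p.159 (class form)] -/
theorem integrable_partIntegrals_cond (hA : A.PosDef) (hκ : 0 < κ) (hJ : CoefSupportedIn a J) (hAc0 : 0 ≤ Ac)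
    (hAc : ∀ p ∈ Finset.Icc 1 s, ∀ (Δ : Fin p → B1Eq324BenfattoLemma.Site d), (∀ i, Δ i ∈ J) →
      ∀ n ∈ admissible p D, |a p Δ n| ≤ Ac)
    (hJI : J ⊆ I) (hγ1 : γ ≤ 1) (hb : 1 ≤ b) (hSΛ : C ∪ corridors L w B ⊆ Λ) (hBΛ : ∀ m ∈ B, box L m ⊆ Λ)
    {Kb : B1Eq324BenfattoLemma.Site d → B1Eq324BenfattoLemma.Site d → B1Eq324BenfattoLemma.Site d → ℝ}
    (hKb : ∀ m (hm : m ∈ B) x y, Kb m x y = if h : x ∈ shrink L m w \ C ∧ y ∈ shrink L m w \ C then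
      ((A.submatrix (fun j : ↥(shrink L m w \ C) => (⟨j, hBΛ m hm (shrink_subset_box L m w (Finset.mem_sdiff.mp j.2).1)⟩ : Λ))
        (fun j : ↥(shrink L m w \ C) => (⟨j, hBΛ m hm (shrink_subset_box L m w (Finset.mem_sdiff.mp j.2).1)⟩ : Λ)))⁻¹ :
          Matrix ↥(shrink L m w \ C) ↥(shrink L m w \ C) ℝ) ⟨x, h.1⟩ ⟨y, h.2⟩ else 0)
    {Kout : B1Eq324BenfattoLemma.Site d → B1Eq324BenfattoLemma.Site d → ℝ}
    (hKout : ∀ x y, Kout x y =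
      if h : x ∈ ((Λ \ (C ∪ corridors L w B)).filter fun x => ∀ m ∈ B, x ∉ box L m) ∧
          y ∈ ((Λ \ (C ∪ corridors L w B)).filter fun x => ∀ m ∈ B, x ∉ box L m) then
        ((A.submatrix
            (fun j : ↥((Λ \ (C ∪ corridors L w B)).filter fun x => ∀ m ∈ B, x ∉ box L m) =>
              (⟨j, (Finset.mem_sdiff.mp (Finset.mem_filter.mp j.2).1).1⟩ : Λ))
            (fun j : ↥((Λ \ (C ∪ corridors L w B)).filter fun x => ∀ m ∈ B, x ∉ box L m) =>
              (⟨j, (Finset.mem_sdiff.mp (Finset.mem_filter.mp j.2).1).1⟩ : Λ)))⁻¹ :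
          Matrix ↥((Λ \ (C ∪ corridors L w B)).filter fun x => ∀ m ∈ B, x ∉ box L m)
            ↥((Λ \ (C ∪ corridors L w B)).filter fun x => ∀ m ∈ B, x ∉ box L m) ℝ) ⟨x, h.1⟩ ⟨y, h.2⟩ else 0)
    (W : B1Eq324BenfattoLemma.Site d → (B1Eq324BenfattoLemma.Site d → ℝ) → ℝ) (hWm : ∀ m, Measurable (W m)) {KW : ℝ}
    (hWb : ∀ m, ∀ z : B1Eq324BenfattoLemma.Site d → ℝ, (∀ x ∈ J, x ∈ box L m → |z x| ≤ b) → |W m z| ≤ KW) (zbar : B1Eq324BenfattoLemma.Site d → ℝ) :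
    Integrable (fun ξ : B1Eq324BenfattoLemma.Site d → ℝ => (smallFieldOn (corridors L w B : Set (B1Eq324BenfattoLemma.Site d)) I (γ * b)).indicator (fun _ => (1 : ℝ)) ξ *
          Real.exp (hamiltonian s D κ a (corridors L w B) ξ) *
        ((∫ z, (smallFieldOn (out L B) I b).indicator (fun _ => (1 : ℝ)) z ∂((gaussianFieldOfKernel Kout).map
              fun (ζ : B1Eq324BenfattoLemma.Site d → ℝ) (x : B1Eq324BenfattoLemma.Site d) => condMean K (C ∪ corridors L w B) ξ x + ζ x)) *
          ∏ m ∈ B, ∫ z, (smallFieldOn (frame1 L w m : Set (B1Eq324BenfattoLemma.Site d)) I (γ * b)).indicator (fun _ => (1 : ℝ)) z *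
              (smallFieldOn (shrink L m w : Set (B1Eq324BenfattoLemma.Site d)) I b).indicator (fun _ => (1 : ℝ)) z * Real.exp (W m z) ∂((gaussianFieldOfKernel (Kb m)).map
              fun (ζ : B1Eq324BenfattoLemma.Site d → ℝ) (x : B1Eq324BenfattoLemma.Site d) => condMean K (C ∪ corridors L w B) ξ x + ζ x))) ((gaussianFieldOfKernel (condCov K C)).map
          fun (ζ : B1Eq324BenfattoLemma.Site d → ℝ) (x : B1Eq324BenfattoLemma.Site d) => condMean K C zbar x + ζ x) ∧
    ∀ ξ : B1Eq324BenfattoLemma.Site d → ℝ, 0 ≤ (smallFieldOn (corridors L w B : Set (B1Eq324BenfattoLemma.Site d)) I (γ * b)).indicator (fun _ => (1 : ℝ)) ξ *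
          Real.exp (hamiltonian s D κ a (corridors L w B) ξ) *
        ((∫ z, (smallFieldOn (out L B) I b).indicator (fun _ => (1 : ℝ)) z ∂((gaussianFieldOfKernel Kout).map
              fun (ζ : B1Eq324BenfattoLemma.Site d → ℝ) (x : B1Eq324BenfattoLemma.Site d) => condMean K (C ∪ corridors L w B) ξ x + ζ x)) *
          ∏ m ∈ B, ∫ z, (smallFieldOn (frame1 L w m : Set (B1Eq324BenfattoLemma.Site d)) I (γ * b)).indicator (fun _ => (1 : ℝ)) z *
              (smallFieldOn (shrink L m w : Set (B1Eq324BenfattoLemma.Site d)) I b).indicator (fun _ => (1 : ℝ)) z * Real.exp (W m z) ∂((gaussianFieldOfKernel (Kb m)).map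
              fun (ζ : B1Eq324BenfattoLemma.Site d → ℝ) (x : B1Eq324BenfattoLemma.Site d) => condMean K (C ∪ corridors L w B) ξ x + ζ x)) := by
  classical
  have hb0 : 0 ≤ b := zero_le_one.trans hb
  have hKpsd : IsPosSemidefKernel K := isPosSemidefKernel_kernel hK hA
  have hCΛ : C ⊆ Λ := Finset.subset_union_left.trans hSΛ
  haveI : IsProbabilityMeasure ((gaussianFieldOfKernel (condCov K C)).map
          fun (ζ : B1Eq324BenfattoLemma.Site d → ℝ) (x : B1Eq324BenfattoLemma.Site d) => condMean K C zbar x + ζ x) :=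
    isProbabilityMeasure_condFieldK hKpsd C (isUnit_det_covGram_kernel hK hA hCΛ) zbar
  have hPDout : (A.submatrix
      (fun j : ↥((Λ \ (C ∪ corridors L w B)).filter fun x => ∀ m ∈ B, x ∉ box L m) =>
        (⟨j, (Finset.mem_sdiff.mp (Finset.mem_filter.mp j.2).1).1⟩ : Λ))
      (fun j : ↥((Λ \ (C ∪ corridors L w B)).filter fun x => ∀ m ∈ B, x ∉ box L m) =>
        (⟨j, (Finset.mem_sdiff.mp (Finset.mem_filter.mp j.2).1).1⟩ : Λ))).PosDef :=
    hA.submatrix fun a b hab => Subtype.ext (by simpa using congrArg Subtype.val hab)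
  have hKoutpsd : IsPosSemidefKernel Kout := isPosSemidefKernel_kernel hKout hPDout
  haveI : IsProbabilityMeasure (gaussianFieldOfKernel Kout) := isProbabilityMeasure_gaussianFieldOfKernel hKoutpsd
  have hKbpsd : ∀ m (hm : m ∈ B), IsPosSemidefKernel (Kb m) := fun m hm =>
    isPosSemidefKernel_kernel (hKb m hm) (hA.submatrix fun a b hab => Subtype.ext (by simpa using congrArg Subtype.val hab))
  have hfar0 : ∀ ξ : B1Eq324BenfattoLemma.Site d → ℝ, 0 ≤ ∫ z, (smallFieldOn (out L B) I b).indicator (fun _ => (1 : ℝ)) z ∂((gaussianFieldOfKernel Kout).map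
              fun (ζ : B1Eq324BenfattoLemma.Site d → ℝ) (x : B1Eq324BenfattoLemma.Site d) => condMean K (C ∪ corridors L w B) ξ x + ζ x) := fun ξ =>
    integral_nonneg fun z => (indicator_smallFieldOn_mem_Icc _ I b z).1
  have hbox0 : ∀ (ξ : B1Eq324BenfattoLemma.Site d → ℝ) (m : B1Eq324BenfattoLemma.Site d), 0 ≤ ∫ z, (smallFieldOn (frame1 L w m : Set (B1Eq324BenfattoLemma.Site d)) I (γ * b)).indicator (fun _ => (1 : ℝ)) z *
              (smallFieldOn (shrink L m w : Set (B1Eq324BenfattoLemma.Site d)) I b).indicator (fun _ => (1 : ℝ)) z * Real.exp (W m z) ∂((gaussianFieldOfKernel (Kb m)).map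
              fun (ζ : B1Eq324BenfattoLemma.Site d → ℝ) (x : B1Eq324BenfattoLemma.Site d) => condMean K (C ∪ corridors L w B) ξ x + ζ x) := fun ξ m =>
    integral_nonneg fun z => mul_nonneg (mul_nonneg (indicator_smallFieldOn_mem_Icc _ I _ z).1 (indicator_smallFieldOn_mem_Icc _ I _ z).1)
      (Real.exp_pos _).le
  refine ⟨?_, fun ξ => mul_nonneg (mul_nonneg (indicator_smallFieldOn_mem_Icc _ I _ ξ).1 (Real.exp_pos _).le)
    (mul_nonneg (hfar0 ξ) (Finset.prod_nonneg fun m _ => hbox0 ξ m))⟩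
  have hLm : Measurable fun ξ : B1Eq324BenfattoLemma.Site d → ℝ => (smallFieldOn (corridors L w B : Set (B1Eq324BenfattoLemma.Site d)) I (γ * b)).indicator (fun _ => (1 : ℝ)) ξ *
          Real.exp (hamiltonian s D κ a (corridors L w B) ξ) *
        ((∫ z, (smallFieldOn (out L B) I b).indicator (fun _ => (1 : ℝ)) z ∂((gaussianFieldOfKernel Kout).map
              fun (ζ : B1Eq324BenfattoLemma.Site d → ℝ) (x : B1Eq324BenfattoLemma.Site d) => condMean K (C ∪ corridors L w B) ξ x + ζ x)) *
          ∏ m ∈ B, ∫ z, (smallFieldOn (frame1 L w m : Set (B1Eq324BenfattoLemma.Site d)) I (γ * b)).indicator (fun _ => (1 : ℝ)) z *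
              (smallFieldOn (shrink L m w : Set (B1Eq324BenfattoLemma.Site d)) I b).indicator (fun _ => (1 : ℝ)) z * Real.exp (W m z) ∂((gaussianFieldOfKernel (Kb m)).map
              fun (ζ : B1Eq324BenfattoLemma.Site d → ℝ) (x : B1Eq324BenfattoLemma.Site d) => condMean K (C ∪ corridors L w B) ξ x + ζ x)) := by
    refine ((measurable_indicator_smallFieldOn _ I (γ * b)).mul (measurable_hamiltonian _).exp).mul
      ((stronglyMeasurable_integral_shift K (C ∪ corridors L w B) (gaussianFieldOfKernel Kout)
        (measurable_indicator_smallFieldOn _ I b)).measurable.mul (Finset.measurable_prod _ fun m hm => ?_))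
    haveI : IsProbabilityMeasure (gaussianFieldOfKernel (Kb m)) := isProbabilityMeasure_gaussianFieldOfKernel (hKbpsd m hm)
    exact (stronglyMeasurable_integral_shift K (C ∪ corridors L w B) (gaussianFieldOfKernel (Kb m))
      (((measurable_indicator_smallFieldOn _ I (γ * b)).mul (measurable_indicator_smallFieldOn _ I b)).mul (hWm m).exp)).measurable
  refine Integrable.of_bound hLm.aestronglyMeasurable
    (Real.exp (s1Const s D d κ * Ac * b ^ D * (corridors L w B).card) * (1 * ∏ _m ∈ B, Real.exp KW)) (ae_of_all _ fun ξ => ?_)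
  haveI : IsProbabilityMeasure ((gaussianFieldOfKernel Kout).map
              fun (ζ : B1Eq324BenfattoLemma.Site d → ℝ) (x : B1Eq324BenfattoLemma.Site d) => condMean K (C ∪ corridors L w B) ξ x + ζ x) :=
    Measure.isProbabilityMeasure_map (measurable_shift _).aemeasurable
  rw [Real.norm_eq_abs, abs_mul]
  refine mul_le_mul (abs_corridorObs_le hκ hJ hAc0 hAc hJI hγ1 hb _ ξ) ?_ (abs_nonneg _) (Real.exp_pos _).le
  rw [abs_mul, Finset.abs_prod]
  refine mul_le_mul ?_ (Finset.prod_le_prod (fun m _ => abs_nonneg _) fun m hm => ?_)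
    (Finset.prod_nonneg fun m _ => abs_nonneg _) zero_le_one
  · have h := norm_integral_le_of_norm_le_const (μ := ((gaussianFieldOfKernel Kout).map
              fun (ζ : B1Eq324BenfattoLemma.Site d → ℝ) (x : B1Eq324BenfattoLemma.Site d) => condMean K (C ∪ corridors L w B) ξ x + ζ x))
      (f := fun z : B1Eq324BenfattoLemma.Site d → ℝ => (smallFieldOn (out L B) I b).indicator (fun _ => (1 : ℝ)) z) (C := 1)
      (ae_of_all _ fun z => by
        rw [Real.norm_eq_abs, abs_of_nonneg (indicator_smallFieldOn_mem_Icc _ I b z).1]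
        exact (indicator_smallFieldOn_mem_Icc _ I b z).2)
    rwa [Real.norm_eq_abs, probReal_univ, mul_one] at h
  · haveI : IsProbabilityMeasure (gaussianFieldOfKernel (Kb m)) := isProbabilityMeasure_gaussianFieldOfKernel (hKbpsd m hm)
    haveI : IsProbabilityMeasure ((gaussianFieldOfKernel (Kb m)).map
              fun (ζ : B1Eq324BenfattoLemma.Site d → ℝ) (x : B1Eq324BenfattoLemma.Site d) => condMean K (C ∪ corridors L w B) ξ x + ζ x) :=
      Measure.isProbabilityMeasure_map (measurable_shift _).aemeasurable
    have h := norm_integral_le_of_norm_le_const (μ := ((gaussianFieldOfKernel (Kb m)).map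
              fun (ζ : B1Eq324BenfattoLemma.Site d → ℝ) (x : B1Eq324BenfattoLemma.Site d) => condMean K (C ∪ corridors L w B) ξ x + ζ x))
      (f := fun z : B1Eq324BenfattoLemma.Site d → ℝ => (smallFieldOn (frame1 L w m : Set (B1Eq324BenfattoLemma.Site d)) I (γ * b)).indicator (fun _ => (1 : ℝ)) z *
              (smallFieldOn (shrink L m w : Set (B1Eq324BenfattoLemma.Site d)) I b).indicator (fun _ => (1 : ℝ)) z * Real.exp (W m z)) (C := Real.exp KW)
      (ae_of_all _ fun z => by
        rw [Real.norm_eq_abs]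
        exact abs_boxObs_le hJI hγ1 hb0 m (hWb m) z)
    rwa [Real.norm_eq_abs, probReal_univ, mul_one] at h

end Light

/-! ## §3  (5.36): (5.13) two-sided under the conditioned class field `P̄^K_{C,z̄}` -/

section Main

variable {Λ : Finset (B1Eq324BenfattoLemma.Site d)} {A : Matrix Λ Λ ℝ}
  {K : B1Eq324BenfattoLemma.Site d → B1Eq324BenfattoLemma.Site d → ℝ}
  (hK : ∀ x y, K x y = if h : x ∈ Λ ∧ y ∈ Λ then (A⁻¹ : Matrix Λ Λ ℝ) ⟨x, h.1⟩ ⟨y, h.2⟩ else 0)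
  {s D : ℕ} {κ : ℝ} {a : Coef d} {J I : Finset (B1Eq324BenfattoLemma.Site d)} {L w : ℕ} {B C : Finset (B1Eq324BenfattoLemma.Site d)}
  {γ b Ac : ℝ}
  (hAs : ∀ e e', A e e' = A e' e) {γA rmax : ℝ} (hγA0 : 0 < γA)
  (hγA : ∀ x : Λ → ℝ, γA * ∑ e, x e ^ 2 ≤ ∑ e, ∑ e', A e e' * x e * x e')
  (hJI : J ⊆ I) (hL : 0 < L) (hγ1 : γ ≤ 1) (hb : 1 ≤ b)
  (hSΛ : C ∪ corridors L w B ⊆ Λ) (hBΛ : ∀ m ∈ B, box L m ⊆ Λ)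
  (π : ↥(Λ \ (C ∪ corridors L w B)) → Option ↥B)
  (hπ : ∀ (y : ↥(Λ \ (C ∪ corridors L w B))) (m : ↥B), π y = some m ↔ (y : B1Eq324BenfattoLemma.Site d) ∈ shrink L (m : B1Eq324BenfattoLemma.Site d) w)
  (r : ↥(Λ \ (C ∪ corridors L w B)) → ℝ)
  (hr : ∀ y : ↥(Λ \ (C ∪ corridors L w B)), ∑ y' : ↥(Λ \ (C ∪ corridors L w B)), (if π y = π y' then (0 : ℝ) else
    |A ⟨y, (Finset.mem_sdiff.mp y.2).1⟩ ⟨y', (Finset.mem_sdiff.mp y'.2).1⟩|) ≤ r y)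
  (hrmax : ∀ y, r y ≤ rmax) (hγr : rmax < γA)
  {Kb : B1Eq324BenfattoLemma.Site d → B1Eq324BenfattoLemma.Site d → B1Eq324BenfattoLemma.Site d → ℝ}
  (hKb : ∀ m (hm : m ∈ B) x y, Kb m x y = if h : x ∈ shrink L m w \ C ∧ y ∈ shrink L m w \ C then
    ((A.submatrix (fun j : ↥(shrink L m w \ C) => (⟨j, hBΛ m hm (shrink_subset_box L m w (Finset.mem_sdiff.mp j.2).1)⟩ : Λ))
      (fun j : ↥(shrink L m w \ C) => (⟨j, hBΛ m hm (shrink_subset_box L m w (Finset.mem_sdiff.mp j.2).1)⟩ : Λ)))⁻¹ :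
        Matrix ↥(shrink L m w \ C) ↥(shrink L m w \ C) ℝ) ⟨x, h.1⟩ ⟨y, h.2⟩ else 0)
  {Kout : B1Eq324BenfattoLemma.Site d → B1Eq324BenfattoLemma.Site d → ℝ}
  (hKout : ∀ x y, Kout x y =
    if h : x ∈ ((Λ \ (C ∪ corridors L w B)).filter fun x => ∀ m ∈ B, x ∉ box L m) ∧
        y ∈ ((Λ \ (C ∪ corridors L w B)).filter fun x => ∀ m ∈ B, x ∉ box L m) then
      ((A.submatrix
          (fun j : ↥((Λ \ (C ∪ corridors L w B)).filter fun x => ∀ m ∈ B, x ∉ box L m) =>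
            (⟨j, (Finset.mem_sdiff.mp (Finset.mem_filter.mp j.2).1).1⟩ : Λ))
          (fun j : ↥((Λ \ (C ∪ corridors L w B)).filter fun x => ∀ m ∈ B, x ∉ box L m) =>
            (⟨j, (Finset.mem_sdiff.mp (Finset.mem_filter.mp j.2).1).1⟩ : Λ)))⁻¹ :
        Matrix ↥((Λ \ (C ∪ corridors L w B)).filter fun x => ∀ m ∈ B, x ∉ box L m)
          ↥((Λ \ (C ∪ corridors L w B)).filter fun x => ∀ m ∈ B, x ∉ box L m) ℝ) ⟨x, h.1⟩ ⟨y, h.2⟩ else 0)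
  {Cu : ℝ}
  (hu : ∀ ξ ∈ smallFieldOn (corridors L w B : Set (B1Eq324BenfattoLemma.Site d)) I (γ * b), ξ ∈ smallFieldOn (C : Set (B1Eq324BenfattoLemma.Site d)) I b →
    ∀ y ∈ Λ \ (C ∪ corridors L w B), |condMean K (C ∪ corridors L w B) ξ y| ≤ Cu * b * (1 + distToRegion I y))
  {T : ℝ} (hT : (1 + Cu) ^ 2 * b ^ 2 * ∑ y : ↥(Λ \ (C ∪ corridors L w B)), r y * (1 + distToRegion I y) ^ 2 ≤ T)

include hK hAs hγA0 hγA hJI hL hγ1 hb hSΛ hBΛ hπ hr hrmax hγr hKb hKout hu hT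

/-- kernel: the inner step at a fixed datum `ξ` small on `C` — the `P̄^K_{C∪Γ₁,ξ}`-integral of §5's product integrand, rewritten with the `Γ₁`-prefactor
pulled out and the far cut-off read inside `Λ` (a.s.), then compared two-sidedly with the product of the part-field integrals ((A) at `Γ := C ∪ Γ₁`,
parts `shrink ∖ C` and the far part, budget from the cut-offs and the centre row). [cite: BenfattoEtAl1978, §5 (5.13) p.155, (5.36) p.159 (class substitute; ours)] -/
private theorem inner_two_sided (W : B1Eq324BenfattoLemma.Site d → (B1Eq324BenfattoLemma.Site d → ℝ) → ℝ)
    (hWdep : ∀ m, ∀ z z' : B1Eq324BenfattoLemma.Site d → ℝ, (∀ x ∈ box L m, z x = z' x) → W m z = W m z')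
    (hWm : ∀ m, Measurable (W m)) {KW : ℝ}
    (hWb : ∀ m, ∀ z : B1Eq324BenfattoLemma.Site d → ℝ, (∀ x ∈ J, x ∈ box L m → |z x| ≤ b) → |W m z| ≤ KW)
    (ξ : B1Eq324BenfattoLemma.Site d → ℝ) (hξC : ξ ∈ smallFieldOn (C : Set (B1Eq324BenfattoLemma.Site d)) I b) :
    (∫ z, (smallFieldOn (corridors L w B : Set (B1Eq324BenfattoLemma.Site d)) I (γ * b)).indicator (fun _ => (1 : ℝ)) z *
          Real.exp (hamiltonian s D κ a (corridors L w B) z) *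
        ((smallFieldOn (out L B) I b).indicator (fun _ => (1 : ℝ)) z *
          ∏ m ∈ B, (smallFieldOn (frame1 L w m : Set (B1Eq324BenfattoLemma.Site d)) I (γ * b)).indicator (fun _ => (1 : ℝ)) z *
              (smallFieldOn (shrink L m w : Set (B1Eq324BenfattoLemma.Site d)) I b).indicator (fun _ => (1 : ℝ)) z * Real.exp (W m z))
        ∂((gaussianFieldOfKernel (condCov K (C ∪ corridors L w B))).map
          fun (ζ : B1Eq324BenfattoLemma.Site d → ℝ) (x : B1Eq324BenfattoLemma.Site d) => condMean K (C ∪ corridors L w B) ξ x + ζ x) =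
      (smallFieldOn (corridors L w B : Set (B1Eq324BenfattoLemma.Site d)) I (γ * b)).indicator (fun _ => (1 : ℝ)) ξ *
          Real.exp (hamiltonian s D κ a (corridors L w B) ξ) *
        ∫ z, ((smallFieldOn (((Λ \ corridors L w B).filter fun x => ∀ m ∈ B, x ∉ box L m : Finset (B1Eq324BenfattoLemma.Site d)) :
              Set (B1Eq324BenfattoLemma.Site d)) I b).indicator (fun _ => (1 : ℝ)) z *
          ∏ m ∈ B, (smallFieldOn (frame1 L w m : Set (B1Eq324BenfattoLemma.Site d)) I (γ * b)).indicator (fun _ => (1 : ℝ)) z *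
              (smallFieldOn (shrink L m w : Set (B1Eq324BenfattoLemma.Site d)) I b).indicator (fun _ => (1 : ℝ)) z * Real.exp (W m z))
        ∂((gaussianFieldOfKernel (condCov K (C ∪ corridors L w B))).map
          fun (ζ : B1Eq324BenfattoLemma.Site d → ℝ) (x : B1Eq324BenfattoLemma.Site d) => condMean K (C ∪ corridors L w B) ξ x + ζ x)) ∧
    Real.exp (-((∑ y, r y) / (γA - rmax) + T / 2)) *
        ((smallFieldOn (corridors L w B : Set (B1Eq324BenfattoLemma.Site d)) I (γ * b)).indicator (fun _ => (1 : ℝ)) ξ *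
            Real.exp (hamiltonian s D κ a (corridors L w B) ξ) *
          ((∫ z, (smallFieldOn (out L B) I b).indicator (fun _ => (1 : ℝ)) z ∂((gaussianFieldOfKernel Kout).map
              fun (ζ : B1Eq324BenfattoLemma.Site d → ℝ) (x : B1Eq324BenfattoLemma.Site d) => condMean K (C ∪ corridors L w B) ξ x + ζ x)) *
            ∏ m ∈ B, ∫ z, (smallFieldOn (frame1 L w m : Set (B1Eq324BenfattoLemma.Site d)) I (γ * b)).indicator (fun _ => (1 : ℝ)) z *
                (smallFieldOn (shrink L m w : Set (B1Eq324BenfattoLemma.Site d)) I b).indicator (fun _ => (1 : ℝ)) z *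
                Real.exp (W m z) ∂((gaussianFieldOfKernel (Kb m)).map
              fun (ζ : B1Eq324BenfattoLemma.Site d → ℝ) (x : B1Eq324BenfattoLemma.Site d) => condMean K (C ∪ corridors L w B) ξ x + ζ x))) ≤
      ∫ z, (smallFieldOn (corridors L w B : Set (B1Eq324BenfattoLemma.Site d)) I (γ * b)).indicator (fun _ => (1 : ℝ)) z *
          Real.exp (hamiltonian s D κ a (corridors L w B) z) *
        ((smallFieldOn (out L B) I b).indicator (fun _ => (1 : ℝ)) z *
          ∏ m ∈ B, (smallFieldOn (frame1 L w m : Set (B1Eq324BenfattoLemma.Site d)) I (γ * b)).indicator (fun _ => (1 : ℝ)) z *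
              (smallFieldOn (shrink L m w : Set (B1Eq324BenfattoLemma.Site d)) I b).indicator (fun _ => (1 : ℝ)) z * Real.exp (W m z))
        ∂((gaussianFieldOfKernel (condCov K (C ∪ corridors L w B))).map
          fun (ζ : B1Eq324BenfattoLemma.Site d → ℝ) (x : B1Eq324BenfattoLemma.Site d) => condMean K (C ∪ corridors L w B) ξ x + ζ x) ∧
    ∫ z, (smallFieldOn (corridors L w B : Set (B1Eq324BenfattoLemma.Site d)) I (γ * b)).indicator (fun _ => (1 : ℝ)) z *
          Real.exp (hamiltonian s D κ a (corridors L w B) z) *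
        ((smallFieldOn (out L B) I b).indicator (fun _ => (1 : ℝ)) z *
          ∏ m ∈ B, (smallFieldOn (frame1 L w m : Set (B1Eq324BenfattoLemma.Site d)) I (γ * b)).indicator (fun _ => (1 : ℝ)) z *
              (smallFieldOn (shrink L m w : Set (B1Eq324BenfattoLemma.Site d)) I b).indicator (fun _ => (1 : ℝ)) z * Real.exp (W m z))
        ∂((gaussianFieldOfKernel (condCov K (C ∪ corridors L w B))).map
          fun (ζ : B1Eq324BenfattoLemma.Site d → ℝ) (x : B1Eq324BenfattoLemma.Site d) => condMean K (C ∪ corridors L w B) ξ x + ζ x) ≤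
      Real.exp ((∑ y, r y) / (γA - rmax) + T / 2) *
        ((smallFieldOn (corridors L w B : Set (B1Eq324BenfattoLemma.Site d)) I (γ * b)).indicator (fun _ => (1 : ℝ)) ξ *
            Real.exp (hamiltonian s D κ a (corridors L w B) ξ) *
          ((∫ z, (smallFieldOn (out L B) I b).indicator (fun _ => (1 : ℝ)) z ∂((gaussianFieldOfKernel Kout).map
              fun (ζ : B1Eq324BenfattoLemma.Site d → ℝ) (x : B1Eq324BenfattoLemma.Site d) => condMean K (C ∪ corridors L w B) ξ x + ζ x)) *
            ∏ m ∈ B, ∫ z, (smallFieldOn (frame1 L w m : Set (B1Eq324BenfattoLemma.Site d)) I (γ * b)).indicator (fun _ => (1 : ℝ)) z *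
                (smallFieldOn (shrink L m w : Set (B1Eq324BenfattoLemma.Site d)) I b).indicator (fun _ => (1 : ℝ)) z *
                Real.exp (W m z) ∂((gaussianFieldOfKernel (Kb m)).map
              fun (ζ : B1Eq324BenfattoLemma.Site d → ℝ) (x : B1Eq324BenfattoLemma.Site d) => condMean K (C ∪ corridors L w B) ξ x + ζ x))) := by
  classical
  have hb0 : 0 ≤ b := zero_le_one.trans hb
  have hA : A.PosDef := posDef_of_coercive hAs hγA0 hγA
  have hKpsd : IsPosSemidefKernel K := isPosSemidefKernel_kernel hK hA
  have hdetΓ : IsUnit (covGram K (C ∪ corridors L w B)).det := isUnit_det_covGram_kernel hK hA hSΛ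
  have hKc : IsPosSemidefKernel (condCov K (C ∪ corridors L w B)) := isPosSemidefKernel_condCov K hKpsd (C ∪ corridors L w B) hdetΓ
  set Pbar := (gaussianFieldOfKernel (condCov K (C ∪ corridors L w B))).map
    fun (ζ : B1Eq324BenfattoLemma.Site d → ℝ) (x : B1Eq324BenfattoLemma.Site d) => condMean K (C ∪ corridors L w B) ξ x + ζ x with hPbar
  haveI : IsProbabilityMeasure Pbar := isProbabilityMeasure_condFieldK hKpsd (C ∪ corridors L w B) hdetΓ ξ
  -- the far part and the parts
  set W₀ : Finset (B1Eq324BenfattoLemma.Site d) := (Λ \ corridors L w B).filter fun x => ∀ m ∈ B, x ∉ box L m with hW₀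
  set F₀ : Finset (B1Eq324BenfattoLemma.Site d) := (Λ \ (C ∪ corridors L w B)).filter fun x => ∀ m ∈ B, x ∉ box L m with hF₀
  set part : Option ↥B → Finset (B1Eq324BenfattoLemma.Site d) := fun p => p.elim F₀ fun m => shrink L (m : B1Eq324BenfattoLemma.Site d) w \ C
    with hpart
  have hpartsub : ∀ p, part p ⊆ Λ \ (C ∪ corridors L w B) := by
    rintro (_ | m)
    · exact Finset.filter_subset _ _
    · exact shrink_sdiff_subset_sdiff_union hL hBΛ m.2
  have hyC : ∀ y : ↥(Λ \ (C ∪ corridors L w B)), (y : B1Eq324BenfattoLemma.Site d) ∉ C := fun y h =>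
    (Finset.mem_sdiff.mp y.2).2 (Finset.mem_union_left _ h)
  have hyΓ : ∀ y : ↥(Λ \ (C ∪ corridors L w B)), (y : B1Eq324BenfattoLemma.Site d) ∉ corridors L w B := fun y h =>
    (Finset.mem_sdiff.mp y.2).2 (Finset.mem_union_right _ h)
  have hpartiff : ∀ p (y : ↥(Λ \ (C ∪ corridors L w B))), (y : B1Eq324BenfattoLemma.Site d) ∈ part p ↔ π y = p := by
    rintro (_ | m) y
    · simp only [hpart, Option.elim]
      constructor
      · intro hy
        rcases hπy : π y with _ | m
        · rfl
        · exfalso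
          have hys := (hπ y m).mp hπy
          exact (Finset.mem_filter.mp hy).2 (m : B1Eq324BenfattoLemma.Site d) m.2 (shrink_subset_box L _ w hys)
      · intro hy
        refine Finset.mem_filter.mpr ⟨y.2, ?_⟩
        rcases mem_corridors_or_shrink_or_out L w B (y : B1Eq324BenfattoLemma.Site d) with h1 | ⟨m, hm, h2⟩ | h3
        · exact absurd h1 (hyΓ y)
        · exact absurd ((hπ y ⟨m, hm⟩).mpr h2) (by rw [hy]; exact (Option.some_ne_none _).symm)
        · exact h3
    · simp only [hpart, Option.elim]
      rw [Finset.mem_sdiff]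
      constructor
      · intro hy
        exact (hπ y m).mpr hy.1
      · intro hy
        exact ⟨(hπ y m).mp hy, hyC y⟩
  -- the part kernels
  set Kp : Option ↥B → B1Eq324BenfattoLemma.Site d → B1Eq324BenfattoLemma.Site d → ℝ :=
    fun p => p.elim Kout fun m => Kb (m : B1Eq324BenfattoLemma.Site d) with hKp
  have hKp' : ∀ p x y, Kp p x y = if h : x ∈ part p ∧ y ∈ part p then
      ((A.submatrix (fun j : ↥(part p) => (⟨j, (Finset.mem_sdiff.mp (hpartsub p j.2)).1⟩ : Λ))
        (fun j : ↥(part p) => (⟨j, (Finset.mem_sdiff.mp (hpartsub p j.2)).1⟩ : Λ)))⁻¹ : Matrix ↥(part p) ↥(part p) ℝ)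
          ⟨x, h.1⟩ ⟨y, h.2⟩ else 0 := by
    rintro (_ | m) x y
    · exact hKout x y
    · exact hKb (m : B1Eq324BenfattoLemma.Site d) m.2 x y
  -- the observables
  set G : Option ↥B → (B1Eq324BenfattoLemma.Site d → ℝ) → ℝ := fun p z =>
    p.elim ((smallFieldOn (W₀ : Set (B1Eq324BenfattoLemma.Site d)) I b).indicator (fun _ => (1 : ℝ)) z) fun m =>
      (smallFieldOn (frame1 L w (m : B1Eq324BenfattoLemma.Site d) : Set (B1Eq324BenfattoLemma.Site d)) I (γ * b)).indicator
          (fun _ => (1 : ℝ)) z *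
        (smallFieldOn (shrink L (m : B1Eq324BenfattoLemma.Site d) w : Set (B1Eq324BenfattoLemma.Site d)) I b).indicator (fun _ => (1 : ℝ)) z *
        Real.exp (W (m : B1Eq324BenfattoLemma.Site d) z) with hG
  have hGm : ∀ p, Measurable (G p) := by
    rintro (_ | m)
    · exact measurable_indicator_smallFieldOn _ I b
    · exact ((measurable_indicator_smallFieldOn _ I (γ * b)).mul (measurable_indicator_smallFieldOn _ I b)).mul
        (hWm (m : B1Eq324BenfattoLemma.Site d)).exp
  have hG0 : ∀ p z, 0 ≤ G p z := by
    rintro (_ | m) z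
    · exact (indicator_smallFieldOn_mem_Icc _ I b z).1
    · exact mul_nonneg (mul_nonneg (indicator_smallFieldOn_mem_Icc _ I _ z).1 (indicator_smallFieldOn_mem_Icc _ I _ z).1) (Real.exp_pos _).le
  set M : Option ↥B → ℝ := fun p => p.elim 1 fun _ => Real.exp KW with hM
  have hGM : ∀ p z, G p z ≤ M p := by
    rintro (_ | m) z
    · exact (indicator_smallFieldOn_mem_Icc _ I b z).2
    · exact (le_abs_self _).trans (abs_boxObs_le hJI hγ1 hb0 (m : B1Eq324BenfattoLemma.Site d) (hWb (m : B1Eq324BenfattoLemma.Site d)) z)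
  have hGdep : ∀ p (z z' : B1Eq324BenfattoLemma.Site d → ℝ), (∀ x, x ∈ part p ∨ x ∈ (C ∪ corridors L w B) → z x = z' x) →
      G p z = G p z' := by
    rintro (_ | m) z z' h
    · refine indicator_smallFieldOn_congr I b fun x hx => h x ?_
      by_cases hxC : x ∈ C
      · exact Or.inr (Finset.mem_union_left _ hxC)
      · left
        have hx' := Finset.mem_filter.mp (Finset.mem_coe.mp hx)
        refine Finset.mem_filter.mpr ⟨Finset.mem_sdiff.mpr ⟨(Finset.mem_sdiff.mp hx'.1).1, ?_⟩, hx'.2⟩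
        rw [Finset.mem_union, not_or]
        exact ⟨hxC, (Finset.mem_sdiff.mp hx'.1).2⟩
    · refine boxObs_congr I γ b L w (m : B1Eq324BenfattoLemma.Site d) (hWdep (m : B1Eq324BenfattoLemma.Site d)) fun x hx => h x ?_
      by_cases hxs : x ∈ shrink L (m : B1Eq324BenfattoLemma.Site d) w
      · by_cases hxC : x ∈ C
        · exact Or.inr (Finset.mem_union_left _ hxC)
        · simp only [hpart, Option.elim]
          exact Or.inl (Finset.mem_sdiff.mpr ⟨hxs, hxC⟩)
      · right
        refine Finset.mem_union_right _ (frame1_subset_corridors L w m.2 ?_)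
        rw [frame1]
        exact Finset.mem_sdiff.mpr ⟨hx, hxs⟩
  -- the cut-offs: on the support of `G p`, the part's sites carry `|z_y| ≤ b(1 + d(I, y))`
  have hGcut : ∀ p (z : B1Eq324BenfattoLemma.Site d → ℝ), G p z ≠ 0 → ∀ y ∈ part p, |z y| ≤ b * (1 + distToRegion I y) := by
    rintro (_ | m) z hz y hy
    · have hzS : z ∈ smallFieldOn (W₀ : Set (B1Eq324BenfattoLemma.Site d)) I b := by
        by_contra hzS
        refine hz ?_
        simp only [hG, Option.elim]
        exact Set.indicator_of_notMem hzS _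
      have hyW : y ∈ W₀ := by
        have hy' := Finset.mem_filter.mp hy
        refine Finset.mem_filter.mpr ⟨Finset.mem_sdiff.mpr ⟨(Finset.mem_sdiff.mp hy'.1).1, fun h => ?_⟩, hy'.2⟩
        exact (Finset.mem_sdiff.mp hy'.1).2 (Finset.mem_union_right _ h)
      exact hzS y (Finset.mem_coe.mpr hyW)
    · have hzS : z ∈ smallFieldOn (shrink L (m : B1Eq324BenfattoLemma.Site d) w : Set (B1Eq324BenfattoLemma.Site d)) I b := by
        by_contra hzS
        refine hz ?_
        simp only [hG, Option.elim]
        rw [Set.indicator_of_notMem hzS, mul_zero, zero_mul]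
      have hy' : y ∈ shrink L (m : B1Eq324BenfattoLemma.Site d) w := by
        simp only [hpart, Option.elim] at hy
        exact (Finset.mem_sdiff.mp hy).1
      exact hzS y (Finset.mem_coe.mpr hy')
  have hr0 : ∀ y, 0 ≤ r y := fun y =>
    le_trans (Finset.sum_nonneg fun y' _ => ite_nonneg le_rfl (abs_nonneg _)) (hr y)
  -- the a.s. identifications under `P̄_ξ`
  have hprod : ∀ z : B1Eq324BenfattoLemma.Site d → ℝ,
      (smallFieldOn (W₀ : Set (B1Eq324BenfattoLemma.Site d)) I b).indicator (fun _ => (1 : ℝ)) z *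
        ∏ m ∈ B, (smallFieldOn (frame1 L w m : Set (B1Eq324BenfattoLemma.Site d)) I (γ * b)).indicator (fun _ => (1 : ℝ)) z *
          (smallFieldOn (shrink L m w : Set (B1Eq324BenfattoLemma.Site d)) I b).indicator (fun _ => (1 : ℝ)) z * Real.exp (W m z)
      = ∏ p, G p z := by
    intro z
    rw [Fintype.prod_option]
    simp only [hG, Option.elim]
    rw [Finset.prod_coe_sort B (fun m => (smallFieldOn (frame1 L w m : Set (B1Eq324BenfattoLemma.Site d)) I (γ * b)).indicator
        (fun _ => (1 : ℝ)) z * (smallFieldOn (shrink L m w : Set (B1Eq324BenfattoLemma.Site d)) I b).indicator (fun _ => (1 : ℝ)) z *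
        Real.exp (W m z))]
  set Hpre : (B1Eq324BenfattoLemma.Site d → ℝ) → ℝ := fun z =>
    (smallFieldOn ((corridors L w B) : Set (B1Eq324BenfattoLemma.Site d)) I (γ * b)).indicator (fun _ => (1 : ℝ)) z *
      Real.exp (hamiltonian s D κ a (corridors L w B) z) with hHpre
  have hHpre_congr : ∀ z : B1Eq324BenfattoLemma.Site d → ℝ, (∀ c ∈ (corridors L w B), z c = ξ c) → Hpre z = Hpre ξ := by
    intro z hz
    simp only [hHpre]
    rw [indicator_smallFieldOn_congr I (γ * b) (fun x hx => hz x (Finset.mem_coe.mp hx)), hamiltonian_congr_eqOn (corridors L w B) hz]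
  have heq1 : ∫ z, Hpre z * ((smallFieldOn (out L B) I b).indicator (fun _ => (1 : ℝ)) z *
        ∏ m ∈ B, (smallFieldOn (frame1 L w m : Set (B1Eq324BenfattoLemma.Site d)) I (γ * b)).indicator (fun _ => (1 : ℝ)) z *
          (smallFieldOn (shrink L m w : Set (B1Eq324BenfattoLemma.Site d)) I b).indicator (fun _ => (1 : ℝ)) z * Real.exp (W m z)) ∂Pbar =
      ∫ z, Hpre ξ * ∏ p, G p z ∂Pbar := by
    refine integral_congr_ae ?_
    filter_upwards [condFieldK_ae_eqOn hKpsd (C ∪ corridors L w B) hdetΓ ξ, condFieldK_ae_eq_zero_of_not_mem hK hA hSΛ ξ] with z hz1 hz2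
    rw [hHpre_congr z (fun c hc => hz1 c (Finset.mem_union_right _ hc)), indicator_smallFieldOn_out_eq_of_eq_zero (L := L) (w := w) (B := B) (I := I) hb0 hz2, hprod z]
  have heq2 : ∫ z, Hpre ξ * ∏ p, G p z ∂Pbar = Hpre ξ * ∫ z, ∏ p, G p z ∂Pbar := integral_const_mul _ _
  have heq3 : ∫ z, ((smallFieldOn (W₀ : Set (B1Eq324BenfattoLemma.Site d)) I b).indicator (fun _ => (1 : ℝ)) z *
        ∏ m ∈ B, (smallFieldOn (frame1 L w m : Set (B1Eq324BenfattoLemma.Site d)) I (γ * b)).indicator (fun _ => (1 : ℝ)) z *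
          (smallFieldOn (shrink L m w : Set (B1Eq324BenfattoLemma.Site d)) I b).indicator (fun _ => (1 : ℝ)) z * Real.exp (W m z)) ∂Pbar =
      ∫ z, ∏ p, G p z ∂Pbar := integral_congr_ae (Filter.Eventually.of_forall fun z => hprod z)
  have hfirst : ∫ z, Hpre z * ((smallFieldOn (out L B) I b).indicator (fun _ => (1 : ℝ)) z *
        ∏ m ∈ B, (smallFieldOn (frame1 L w m : Set (B1Eq324BenfattoLemma.Site d)) I (γ * b)).indicator (fun _ => (1 : ℝ)) z *
          (smallFieldOn (shrink L m w : Set (B1Eq324BenfattoLemma.Site d)) I b).indicator (fun _ => (1 : ℝ)) z * Real.exp (W m z)) ∂Pbar =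
      Hpre ξ * ∫ z, ((smallFieldOn (W₀ : Set (B1Eq324BenfattoLemma.Site d)) I b).indicator (fun _ => (1 : ℝ)) z *
        ∏ m ∈ B, (smallFieldOn (frame1 L w m : Set (B1Eq324BenfattoLemma.Site d)) I (γ * b)).indicator (fun _ => (1 : ℝ)) z *
          (smallFieldOn (shrink L m w : Set (B1Eq324BenfattoLemma.Site d)) I b).indicator (fun _ => (1 : ℝ)) z * Real.exp (W m z)) ∂Pbar := by
    rw [heq1, heq2, heq3]
  -- the product of the part-field integrals, with the far cut-off read on all of `out`
  set N : Option ↥B → Measure (B1Eq324BenfattoLemma.Site d → ℝ) := fun p => (gaussianFieldOfKernel (Kp p)).map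
    fun (ζ : B1Eq324BenfattoLemma.Site d → ℝ) (x : B1Eq324BenfattoLemma.Site d) => condMean K (C ∪ corridors L w B) ξ x + ζ x with hN
  have hfar : ∫ z, G none z ∂(N none) = ∫ z, (smallFieldOn (out L B) I b).indicator (fun _ => (1 : ℝ)) z ∂(N none) := by
    refine integral_congr_ae ?_
    filter_upwards [partField_ae_eq_condMean_of_not_mem (A := A) hA (hpartsub none) (hKp' none) ξ] with z hz
    have hz0 : ∀ x, x ∉ Λ → z x = 0 := fun x hx => by
      rw [hz x fun hxF => hx (Finset.mem_sdiff.mp (hpartsub none hxF)).1]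
      exact condMean_kernel_eq_zero_of_not_mem hK (C ∪ corridors L w B) ξ hx
    simp only [hG, Option.elim]
    exact (indicator_smallFieldOn_out_eq_of_eq_zero (L := L) (w := w) (B := B) (I := I) hb0 hz0).symm
  have hprodN : ∏ p, ∫ z, G p z ∂(N p) =
      (∫ z, (smallFieldOn (out L B) I b).indicator (fun _ => (1 : ℝ)) z ∂(N none)) *
        ∏ m ∈ B, ∫ z, (smallFieldOn (frame1 L w m : Set (B1Eq324BenfattoLemma.Site d)) I (γ * b)).indicator (fun _ => (1 : ℝ)) z *
          (smallFieldOn (shrink L m w : Set (B1Eq324BenfattoLemma.Site d)) I b).indicator (fun _ => (1 : ℝ)) z * Real.exp (W m z)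
            ∂((gaussianFieldOfKernel (Kb m)).map
              fun (ζ : B1Eq324BenfattoLemma.Site d → ℝ) (x : B1Eq324BenfattoLemma.Site d) => condMean K (C ∪ corridors L w B) ξ x + ζ x) := by
    rw [Fintype.prod_option, hfar]
    congr 1
    simp only [hN, hKp, hG, Option.elim]
    exact Finset.prod_coe_sort B (fun m => ∫ z, (smallFieldOn (frame1 L w m : Set (B1Eq324BenfattoLemma.Site d)) I (γ * b)).indicator
        (fun _ => (1 : ℝ)) z * (smallFieldOn (shrink L m w : Set (B1Eq324BenfattoLemma.Site d)) I b).indicator (fun _ => (1 : ℝ)) z *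
        Real.exp (W m z) ∂((gaussianFieldOfKernel (Kb m)).map
          fun (ζ : B1Eq324BenfattoLemma.Site d → ℝ) (x : B1Eq324BenfattoLemma.Site d) => condMean K (C ∪ corridors L w B) ξ x + ζ x))
  -- §1 on the corridor event; trivial off it
  refine ⟨hfirst, ?_, ?_⟩
  · rw [hfirst]
    by_cases hξ : ξ ∈ smallFieldOn ((corridors L w B) : Set (B1Eq324BenfattoLemma.Site d)) I (γ * b)
    · have hGt : ∀ p (z : B1Eq324BenfattoLemma.Site d → ℝ), G p z ≠ 0 → ∀ y : ↥(Λ \ (C ∪ corridors L w B)), (y : B1Eq324BenfattoLemma.Site d) ∈ part p →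
          r y * (z y - condMean K (C ∪ corridors L w B) ξ y) ^ 2 ≤ r y * ((1 + Cu) * b * (1 + distToRegion I y)) ^ 2 := by
        intro p z hz y hy
        refine mul_le_mul_of_nonneg_left (sq_le_sq' ?_ ?_) (hr0 y)
        · have h1 := hGcut p z hz y hy
          have h2 := hu ξ hξ hξC y y.2
          have hd := distToRegion_nonneg I (y : B1Eq324BenfattoLemma.Site d)
          nlinarith [abs_le.mp h1, abs_le.mp h2]
        · have h1 := hGcut p z hz y hy
          have h2 := hu ξ hξ hξC y y.2
          have hd := distToRegion_nonneg I (y : B1Eq324BenfattoLemma.Site d)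
          nlinarith [abs_le.mp h1, abs_le.mp h2]
      have hT' : ∑ y : ↥(Λ \ (C ∪ corridors L w B)), r y * ((1 + Cu) * b * (1 + distToRegion I y)) ^ 2 ≤ T := by
        refine le_trans (le_of_eq ?_) hT
        rw [Finset.mul_sum]
        exact Finset.sum_congr rfl fun y _ => by ring
      have hcore := exp_mul_prod_integral_part_le_integral_prod_condFieldK hK hAs hγA0 hγA hSΛ π r hr hrmax hγr ξ part hpartsub
        hpartiff hKp' hGm hG0 hGM hGdep hGt hT'
      rw [hprodN] at hcore
      have hH0 : 0 ≤ Hpre ξ := mul_nonneg (indicator_smallFieldOn_mem_Icc _ I _ ξ).1 (Real.exp_pos _).le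
      calc Real.exp (-((∑ y, r y) / (γA - rmax) + T / 2)) * (Hpre ξ * ((∫ z, (smallFieldOn (out L B) I b).indicator
              (fun _ => (1 : ℝ)) z ∂(N none)) * ∏ m ∈ B, ∫ z, (smallFieldOn (frame1 L w m : Set (B1Eq324BenfattoLemma.Site d)) I
              (γ * b)).indicator (fun _ => (1 : ℝ)) z * (smallFieldOn (shrink L m w : Set (B1Eq324BenfattoLemma.Site d)) I b).indicator
              (fun _ => (1 : ℝ)) z * Real.exp (W m z) ∂((gaussianFieldOfKernel (Kb m)).map
              fun (ζ : B1Eq324BenfattoLemma.Site d → ℝ) (x : B1Eq324BenfattoLemma.Site d) => condMean K (C ∪ corridors L w B) ξ x + ζ x)))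
          = Hpre ξ * (Real.exp (-((∑ y, r y) / (γA - rmax) + T / 2)) * ((∫ z, (smallFieldOn (out L B) I b).indicator
              (fun _ => (1 : ℝ)) z ∂(N none)) * ∏ m ∈ B, ∫ z, (smallFieldOn (frame1 L w m : Set (B1Eq324BenfattoLemma.Site d)) I
              (γ * b)).indicator (fun _ => (1 : ℝ)) z * (smallFieldOn (shrink L m w : Set (B1Eq324BenfattoLemma.Site d)) I b).indicator
              (fun _ => (1 : ℝ)) z * Real.exp (W m z) ∂((gaussianFieldOfKernel (Kb m)).map
              fun (ζ : B1Eq324BenfattoLemma.Site d → ℝ) (x : B1Eq324BenfattoLemma.Site d) => condMean K (C ∪ corridors L w B) ξ x + ζ x))) := by ring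
        _ ≤ Hpre ξ * ∫ z, ∏ p, G p z ∂Pbar := mul_le_mul_of_nonneg_left hcore hH0
        _ = _ := by rw [heq3]
    · have hH : Hpre ξ = 0 := by
        simp only [hHpre]
        rw [Set.indicator_of_notMem hξ, zero_mul]
      rw [hH, Set.indicator_of_notMem hξ]
      simp
  · rw [hfirst]
    by_cases hξ : ξ ∈ smallFieldOn ((corridors L w B) : Set (B1Eq324BenfattoLemma.Site d)) I (γ * b)
    · have hGt : ∀ p (z : B1Eq324BenfattoLemma.Site d → ℝ), G p z ≠ 0 → ∀ y : ↥(Λ \ (C ∪ corridors L w B)), (y : B1Eq324BenfattoLemma.Site d) ∈ part p →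
          r y * (z y - condMean K (C ∪ corridors L w B) ξ y) ^ 2 ≤ r y * ((1 + Cu) * b * (1 + distToRegion I y)) ^ 2 := by
        intro p z hz y hy
        refine mul_le_mul_of_nonneg_left (sq_le_sq' ?_ ?_) (hr0 y)
        · have h1 := hGcut p z hz y hy
          have h2 := hu ξ hξ hξC y y.2
          have hd := distToRegion_nonneg I (y : B1Eq324BenfattoLemma.Site d)
          nlinarith [abs_le.mp h1, abs_le.mp h2]
        · have h1 := hGcut p z hz y hy
          have h2 := hu ξ hξ hξC y y.2
          have hd := distToRegion_nonneg I (y : B1Eq324BenfattoLemma.Site d)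
          nlinarith [abs_le.mp h1, abs_le.mp h2]
      have hT' : ∑ y : ↥(Λ \ (C ∪ corridors L w B)), r y * ((1 + Cu) * b * (1 + distToRegion I y)) ^ 2 ≤ T := by
        refine le_trans (le_of_eq ?_) hT
        rw [Finset.mul_sum]
        exact Finset.sum_congr rfl fun y _ => by ring
      have hcore := integral_prod_condFieldK_le_exp_mul_prod_integral_part hK hAs hγA0 hγA hSΛ π r hr hrmax hγr ξ part hpartsub
        hpartiff hKp' hGm hG0 hGM hGdep hGt hT'
      rw [hprodN] at hcore
      have hH0 : 0 ≤ Hpre ξ := mul_nonneg (indicator_smallFieldOn_mem_Icc _ I _ ξ).1 (Real.exp_pos _).le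
      calc Hpre ξ * ∫ z, ((smallFieldOn (W₀ : Set (B1Eq324BenfattoLemma.Site d)) I b).indicator (fun _ => (1 : ℝ)) z *
              ∏ m ∈ B, (smallFieldOn (frame1 L w m : Set (B1Eq324BenfattoLemma.Site d)) I (γ * b)).indicator (fun _ => (1 : ℝ)) z *
                (smallFieldOn (shrink L m w : Set (B1Eq324BenfattoLemma.Site d)) I b).indicator (fun _ => (1 : ℝ)) z * Real.exp (W m z)) ∂Pbar
          = Hpre ξ * ∫ z, ∏ p, G p z ∂Pbar := by rw [heq3]
        _ ≤ Hpre ξ * (Real.exp ((∑ y, r y) / (γA - rmax) + T / 2) * ((∫ z, (smallFieldOn (out L B) I b).indicator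
              (fun _ => (1 : ℝ)) z ∂(N none)) * ∏ m ∈ B, ∫ z, (smallFieldOn (frame1 L w m : Set (B1Eq324BenfattoLemma.Site d)) I
              (γ * b)).indicator (fun _ => (1 : ℝ)) z * (smallFieldOn (shrink L m w : Set (B1Eq324BenfattoLemma.Site d)) I b).indicator
              (fun _ => (1 : ℝ)) z * Real.exp (W m z) ∂((gaussianFieldOfKernel (Kb m)).map
              fun (ζ : B1Eq324BenfattoLemma.Site d → ℝ) (x : B1Eq324BenfattoLemma.Site d) => condMean K (C ∪ corridors L w B) ξ x + ζ x))) := mul_le_mul_of_nonneg_left hcore hH0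
        _ = _ := by
          simp only [hHpre, hN, hKp, Option.elim]
          ring
    · have hH : Hpre ξ = 0 := by
        simp only [hHpre]
        rw [Set.indicator_of_notMem hξ, zero_mul]
      rw [hH, Set.indicator_of_notMem hξ]
      simp



/-- kernel: the integrated two-sided comparison under `P̄^K_{C,z̄}` (two-stage tower; both directions share the integrability bookkeeping).
[cite: BenfattoEtAl1978, §5 (5.13) p.155, (5.36) p.159 (class substitute at temperature zero; ours)] -/
private theorem integrated_two_sided (hκ : 0 < κ) (hJ : CoefSupportedIn a J) (hAc0 : 0 ≤ Ac)
    (hAc : ∀ p ∈ Finset.Icc 1 s, ∀ (Δ : Fin p → B1Eq324BenfattoLemma.Site d), (∀ i, Δ i ∈ J) →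
      ∀ n ∈ admissible p D, |a p Δ n| ≤ Ac)
    (W : B1Eq324BenfattoLemma.Site d → (B1Eq324BenfattoLemma.Site d → ℝ) → ℝ)
    (hWdep : ∀ m, ∀ z z' : B1Eq324BenfattoLemma.Site d → ℝ, (∀ x ∈ box L m, z x = z' x) → W m z = W m z')
    (hWm : ∀ m, Measurable (W m)) {KW : ℝ}
    (hWb : ∀ m, ∀ z : B1Eq324BenfattoLemma.Site d → ℝ, (∀ x ∈ J, x ∈ box L m → |z x| ≤ b) → |W m z| ≤ KW)
    (zbar : B1Eq324BenfattoLemma.Site d → ℝ) (hzbar : zbar ∈ smallFieldOn (C : Set (B1Eq324BenfattoLemma.Site d)) I b) :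
    Real.exp (-((∑ y, r y) / (γA - rmax) + T / 2)) *
      ∫ ξ, (smallFieldOn (corridors L w B : Set (B1Eq324BenfattoLemma.Site d)) I (γ * b)).indicator (fun _ => (1 : ℝ)) ξ *
          Real.exp (hamiltonian s D κ a (corridors L w B) ξ) *
        ((∫ z, (smallFieldOn (out L B) I b).indicator (fun _ => (1 : ℝ)) z ∂((gaussianFieldOfKernel Kout).map
              fun (ζ : B1Eq324BenfattoLemma.Site d → ℝ) (x : B1Eq324BenfattoLemma.Site d) => condMean K (C ∪ corridors L w B) ξ x + ζ x)) *
          ∏ m ∈ B, ∫ z, (smallFieldOn (frame1 L w m : Set (B1Eq324BenfattoLemma.Site d)) I (γ * b)).indicator (fun _ => (1 : ℝ)) z *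
              (smallFieldOn (shrink L m w : Set (B1Eq324BenfattoLemma.Site d)) I b).indicator (fun _ => (1 : ℝ)) z * Real.exp (W m z) ∂((gaussianFieldOfKernel (Kb m)).map
              fun (ζ : B1Eq324BenfattoLemma.Site d → ℝ) (x : B1Eq324BenfattoLemma.Site d) => condMean K (C ∪ corridors L w B) ξ x + ζ x)) ∂((gaussianFieldOfKernel (condCov K C)).map
          fun (ζ : B1Eq324BenfattoLemma.Site d → ℝ) (x : B1Eq324BenfattoLemma.Site d) => condMean K C zbar x + ζ x) ≤
      ∫ z, (smallFieldOn (corridors L w B : Set (B1Eq324BenfattoLemma.Site d)) I (γ * b)).indicator (fun _ => (1 : ℝ)) z *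
          Real.exp (hamiltonian s D κ a (corridors L w B) z) *
        ((smallFieldOn (out L B) I b).indicator (fun _ => (1 : ℝ)) z *
          ∏ m ∈ B, (smallFieldOn (frame1 L w m : Set (B1Eq324BenfattoLemma.Site d)) I (γ * b)).indicator (fun _ => (1 : ℝ)) z *
              (smallFieldOn (shrink L m w : Set (B1Eq324BenfattoLemma.Site d)) I b).indicator (fun _ => (1 : ℝ)) z * Real.exp (W m z)) ∂((gaussianFieldOfKernel (condCov K C)).map
          fun (ζ : B1Eq324BenfattoLemma.Site d → ℝ) (x : B1Eq324BenfattoLemma.Site d) => condMean K C zbar x + ζ x) ∧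
    ∫ z, (smallFieldOn (corridors L w B : Set (B1Eq324BenfattoLemma.Site d)) I (γ * b)).indicator (fun _ => (1 : ℝ)) z *
          Real.exp (hamiltonian s D κ a (corridors L w B) z) *
        ((smallFieldOn (out L B) I b).indicator (fun _ => (1 : ℝ)) z *
          ∏ m ∈ B, (smallFieldOn (frame1 L w m : Set (B1Eq324BenfattoLemma.Site d)) I (γ * b)).indicator (fun _ => (1 : ℝ)) z *
              (smallFieldOn (shrink L m w : Set (B1Eq324BenfattoLemma.Site d)) I b).indicator (fun _ => (1 : ℝ)) z * Real.exp (W m z)) ∂((gaussianFieldOfKernel (condCov K C)).map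
          fun (ζ : B1Eq324BenfattoLemma.Site d → ℝ) (x : B1Eq324BenfattoLemma.Site d) => condMean K C zbar x + ζ x) ≤
      Real.exp ((∑ y, r y) / (γA - rmax) + T / 2) *
      ∫ ξ, (smallFieldOn (corridors L w B : Set (B1Eq324BenfattoLemma.Site d)) I (γ * b)).indicator (fun _ => (1 : ℝ)) ξ *
          Real.exp (hamiltonian s D κ a (corridors L w B) ξ) *
        ((∫ z, (smallFieldOn (out L B) I b).indicator (fun _ => (1 : ℝ)) z ∂((gaussianFieldOfKernel Kout).map
              fun (ζ : B1Eq324BenfattoLemma.Site d → ℝ) (x : B1Eq324BenfattoLemma.Site d) => condMean K (C ∪ corridors L w B) ξ x + ζ x)) *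
          ∏ m ∈ B, ∫ z, (smallFieldOn (frame1 L w m : Set (B1Eq324BenfattoLemma.Site d)) I (γ * b)).indicator (fun _ => (1 : ℝ)) z *
              (smallFieldOn (shrink L m w : Set (B1Eq324BenfattoLemma.Site d)) I b).indicator (fun _ => (1 : ℝ)) z * Real.exp (W m z) ∂((gaussianFieldOfKernel (Kb m)).map
              fun (ζ : B1Eq324BenfattoLemma.Site d → ℝ) (x : B1Eq324BenfattoLemma.Site d) => condMean K (C ∪ corridors L w B) ξ x + ζ x)) ∂((gaussianFieldOfKernel (condCov K C)).map
          fun (ζ : B1Eq324BenfattoLemma.Site d → ℝ) (x : B1Eq324BenfattoLemma.Site d) => condMean K C zbar x + ζ x) := by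
  classical
  have hb0 : 0 ≤ b := zero_le_one.trans hb
  have hA : A.PosDef := posDef_of_coercive hAs hγA0 hγA
  have hKpsd : IsPosSemidefKernel K := isPosSemidefKernel_kernel hK hA
  have hCΛ : C ⊆ Λ := Finset.subset_union_left.trans hSΛ
  have hdetC : IsUnit (covGram K C).det := isUnit_det_covGram_kernel hK hA hCΛ
  have hdetS : IsUnit (covGram K (C ∪ corridors L w B)).det := isUnit_det_covGram_kernel hK hA hSΛ
  have hKS : IsPosSemidefKernel (condCov K (C ∪ corridors L w B)) := isPosSemidefKernel_condCov K hKpsd (C ∪ corridors L w B) hdetS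
  haveI : IsProbabilityMeasure ((gaussianFieldOfKernel (condCov K C)).map
          fun (ζ : B1Eq324BenfattoLemma.Site d → ℝ) (x : B1Eq324BenfattoLemma.Site d) => condMean K C zbar x + ζ x) :=
    isProbabilityMeasure_condFieldK hKpsd C hdetC zbar
  haveI : IsProbabilityMeasure (gaussianFieldOfKernel (condCov K (C ∪ corridors L w B))) := isProbabilityMeasure_gaussianFieldOfKernel hKS
  have hWb' := hWb
  -- the integrand: measurable and bounded
  have hΦm : Measurable fun z : B1Eq324BenfattoLemma.Site d → ℝ => (smallFieldOn (corridors L w B : Set (B1Eq324BenfattoLemma.Site d)) I (γ * b)).indicator (fun _ => (1 : ℝ)) z *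
          Real.exp (hamiltonian s D κ a (corridors L w B) z) *
        ((smallFieldOn (out L B) I b).indicator (fun _ => (1 : ℝ)) z *
          ∏ m ∈ B, (smallFieldOn (frame1 L w m : Set (B1Eq324BenfattoLemma.Site d)) I (γ * b)).indicator (fun _ => (1 : ℝ)) z *
              (smallFieldOn (shrink L m w : Set (B1Eq324BenfattoLemma.Site d)) I b).indicator (fun _ => (1 : ℝ)) z * Real.exp (W m z)) := by
    refine ((measurable_indicator_smallFieldOn _ I (γ * b)).mul (measurable_hamiltonian _).exp).mul
      ((measurable_indicator_smallFieldOn _ I b).mul (Finset.measurable_prod _ fun m _ => ?_))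
    exact ((measurable_indicator_smallFieldOn _ I (γ * b)).mul (measurable_indicator_smallFieldOn _ I b)).mul (hWm m).exp
  have hΦb : ∀ z : B1Eq324BenfattoLemma.Site d → ℝ, |(smallFieldOn (corridors L w B : Set (B1Eq324BenfattoLemma.Site d)) I (γ * b)).indicator (fun _ => (1 : ℝ)) z *
          Real.exp (hamiltonian s D κ a (corridors L w B) z) *
        ((smallFieldOn (out L B) I b).indicator (fun _ => (1 : ℝ)) z *
          ∏ m ∈ B, (smallFieldOn (frame1 L w m : Set (B1Eq324BenfattoLemma.Site d)) I (γ * b)).indicator (fun _ => (1 : ℝ)) z *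
              (smallFieldOn (shrink L m w : Set (B1Eq324BenfattoLemma.Site d)) I b).indicator (fun _ => (1 : ℝ)) z * Real.exp (W m z))| ≤
      Real.exp (s1Const s D d κ * Ac * b ^ D * (corridors L w B).card) * (1 * ∏ _m ∈ B, Real.exp KW) := by
    intro z
    rw [abs_mul]
    refine mul_le_mul (abs_corridorObs_le hκ hJ hAc0 hAc hJI hγ1 hb _ z) ?_ (abs_nonneg _) (Real.exp_pos _).le
    rw [abs_mul, Finset.abs_prod]
    refine mul_le_mul ?_ (Finset.prod_le_prod (fun m _ => abs_nonneg _)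
      fun m _ => abs_boxObs_le hJI hγ1 hb0 m (hWb m) z) (Finset.prod_nonneg fun m _ => abs_nonneg _) zero_le_one
    rw [abs_of_nonneg (indicator_smallFieldOn_mem_Icc _ I b z).1]
    exact (indicator_smallFieldOn_mem_Icc _ I b z).2
  have hΦi : Integrable (fun z : B1Eq324BenfattoLemma.Site d → ℝ => (smallFieldOn (corridors L w B : Set (B1Eq324BenfattoLemma.Site d)) I (γ * b)).indicator (fun _ => (1 : ℝ)) z *
          Real.exp (hamiltonian s D κ a (corridors L w B) z) *
        ((smallFieldOn (out L B) I b).indicator (fun _ => (1 : ℝ)) z *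
          ∏ m ∈ B, (smallFieldOn (frame1 L w m : Set (B1Eq324BenfattoLemma.Site d)) I (γ * b)).indicator (fun _ => (1 : ℝ)) z *
              (smallFieldOn (shrink L m w : Set (B1Eq324BenfattoLemma.Site d)) I b).indicator (fun _ => (1 : ℝ)) z * Real.exp (W m z))) ((gaussianFieldOfKernel (condCov K C)).map
          fun (ζ : B1Eq324BenfattoLemma.Site d → ℝ) (x : B1Eq324BenfattoLemma.Site d) => condMean K C zbar x + ζ x) :=
    Integrable.of_bound hΦm.aestronglyMeasurable _ (ae_of_all _ fun z => by rw [Real.norm_eq_abs]; exact hΦb z)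
  -- the part fields are probability measures; the parametrised part integrals are measurable and bounded
  have hPDout : (A.submatrix
      (fun j : ↥((Λ \ (C ∪ corridors L w B)).filter fun x => ∀ m ∈ B, x ∉ box L m) =>
        (⟨j, (Finset.mem_sdiff.mp (Finset.mem_filter.mp j.2).1).1⟩ : Λ))
      (fun j : ↥((Λ \ (C ∪ corridors L w B)).filter fun x => ∀ m ∈ B, x ∉ box L m) =>
        (⟨j, (Finset.mem_sdiff.mp (Finset.mem_filter.mp j.2).1).1⟩ : Λ))).PosDef :=
    hA.submatrix fun a b hab => Subtype.ext (by simpa using congrArg Subtype.val hab)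
  have hKoutpsd : IsPosSemidefKernel Kout := isPosSemidefKernel_kernel hKout hPDout
  haveI : IsProbabilityMeasure (gaussianFieldOfKernel Kout) := isProbabilityMeasure_gaussianFieldOfKernel hKoutpsd
  have hKbpsd : ∀ m (hm : m ∈ B), IsPosSemidefKernel (Kb m) := fun m hm =>
    isPosSemidefKernel_kernel (hKb m hm) (hA.submatrix fun a b hab => Subtype.ext (by simpa using congrArg Subtype.val hab))
  have hLm : Measurable fun ξ : B1Eq324BenfattoLemma.Site d → ℝ => (smallFieldOn (corridors L w B : Set (B1Eq324BenfattoLemma.Site d)) I (γ * b)).indicator (fun _ => (1 : ℝ)) ξ *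
          Real.exp (hamiltonian s D κ a (corridors L w B) ξ) *
        ((∫ z, (smallFieldOn (out L B) I b).indicator (fun _ => (1 : ℝ)) z ∂((gaussianFieldOfKernel Kout).map
              fun (ζ : B1Eq324BenfattoLemma.Site d → ℝ) (x : B1Eq324BenfattoLemma.Site d) => condMean K (C ∪ corridors L w B) ξ x + ζ x)) *
          ∏ m ∈ B, ∫ z, (smallFieldOn (frame1 L w m : Set (B1Eq324BenfattoLemma.Site d)) I (γ * b)).indicator (fun _ => (1 : ℝ)) z *
              (smallFieldOn (shrink L m w : Set (B1Eq324BenfattoLemma.Site d)) I b).indicator (fun _ => (1 : ℝ)) z * Real.exp (W m z) ∂((gaussianFieldOfKernel (Kb m)).map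
              fun (ζ : B1Eq324BenfattoLemma.Site d → ℝ) (x : B1Eq324BenfattoLemma.Site d) => condMean K (C ∪ corridors L w B) ξ x + ζ x)) := by
    refine ((measurable_indicator_smallFieldOn _ I (γ * b)).mul (measurable_hamiltonian _).exp).mul
      ((stronglyMeasurable_integral_shift K (C ∪ corridors L w B) (gaussianFieldOfKernel Kout)
        (measurable_indicator_smallFieldOn _ I b)).measurable.mul (Finset.measurable_prod _ fun m hm => ?_))
    haveI : IsProbabilityMeasure (gaussianFieldOfKernel (Kb m)) := isProbabilityMeasure_gaussianFieldOfKernel (hKbpsd m hm)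
    exact (stronglyMeasurable_integral_shift K (C ∪ corridors L w B) (gaussianFieldOfKernel (Kb m))
      (((measurable_indicator_smallFieldOn _ I (γ * b)).mul (measurable_indicator_smallFieldOn _ I b)).mul (hWm m).exp)).measurable
  have hLb : ∀ ξ : B1Eq324BenfattoLemma.Site d → ℝ, ‖(smallFieldOn (corridors L w B : Set (B1Eq324BenfattoLemma.Site d)) I (γ * b)).indicator (fun _ => (1 : ℝ)) ξ *
          Real.exp (hamiltonian s D κ a (corridors L w B) ξ) *
        ((∫ z, (smallFieldOn (out L B) I b).indicator (fun _ => (1 : ℝ)) z ∂((gaussianFieldOfKernel Kout).map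
              fun (ζ : B1Eq324BenfattoLemma.Site d → ℝ) (x : B1Eq324BenfattoLemma.Site d) => condMean K (C ∪ corridors L w B) ξ x + ζ x)) *
          ∏ m ∈ B, ∫ z, (smallFieldOn (frame1 L w m : Set (B1Eq324BenfattoLemma.Site d)) I (γ * b)).indicator (fun _ => (1 : ℝ)) z *
              (smallFieldOn (shrink L m w : Set (B1Eq324BenfattoLemma.Site d)) I b).indicator (fun _ => (1 : ℝ)) z * Real.exp (W m z) ∂((gaussianFieldOfKernel (Kb m)).map
              fun (ζ : B1Eq324BenfattoLemma.Site d → ℝ) (x : B1Eq324BenfattoLemma.Site d) => condMean K (C ∪ corridors L w B) ξ x + ζ x))‖ ≤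
      Real.exp (s1Const s D d κ * Ac * b ^ D * (corridors L w B).card) * (1 * ∏ _m ∈ B, Real.exp KW) := by
    intro ξ
    haveI : IsProbabilityMeasure ((gaussianFieldOfKernel Kout).map
              fun (ζ : B1Eq324BenfattoLemma.Site d → ℝ) (x : B1Eq324BenfattoLemma.Site d) => condMean K (C ∪ corridors L w B) ξ x + ζ x) :=
      Measure.isProbabilityMeasure_map (measurable_shift _).aemeasurable
    rw [Real.norm_eq_abs, abs_mul]
    refine mul_le_mul (abs_corridorObs_le hκ hJ hAc0 hAc hJI hγ1 hb _ ξ) ?_ (abs_nonneg _) (Real.exp_pos _).le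
    rw [abs_mul, Finset.abs_prod]
    refine mul_le_mul ?_ (Finset.prod_le_prod (fun m _ => abs_nonneg _) fun m hm => ?_)
      (Finset.prod_nonneg fun m _ => abs_nonneg _) zero_le_one
    · have h := norm_integral_le_of_norm_le_const (μ := ((gaussianFieldOfKernel Kout).map
              fun (ζ : B1Eq324BenfattoLemma.Site d → ℝ) (x : B1Eq324BenfattoLemma.Site d) => condMean K (C ∪ corridors L w B) ξ x + ζ x))
        (f := fun z : B1Eq324BenfattoLemma.Site d → ℝ => (smallFieldOn (out L B) I b).indicator (fun _ => (1 : ℝ)) z) (C := 1)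
        (ae_of_all _ fun z => by
          rw [Real.norm_eq_abs, abs_of_nonneg (indicator_smallFieldOn_mem_Icc _ I b z).1]
          exact (indicator_smallFieldOn_mem_Icc _ I b z).2)
      rwa [Real.norm_eq_abs, probReal_univ, mul_one] at h
    · haveI : IsProbabilityMeasure (gaussianFieldOfKernel (Kb m)) := isProbabilityMeasure_gaussianFieldOfKernel (hKbpsd m hm)
      haveI : IsProbabilityMeasure ((gaussianFieldOfKernel (Kb m)).map
              fun (ζ : B1Eq324BenfattoLemma.Site d → ℝ) (x : B1Eq324BenfattoLemma.Site d) => condMean K (C ∪ corridors L w B) ξ x + ζ x) :=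
        Measure.isProbabilityMeasure_map (measurable_shift _).aemeasurable
      have h := norm_integral_le_of_norm_le_const (μ := ((gaussianFieldOfKernel (Kb m)).map
              fun (ζ : B1Eq324BenfattoLemma.Site d → ℝ) (x : B1Eq324BenfattoLemma.Site d) => condMean K (C ∪ corridors L w B) ξ x + ζ x))
        (f := fun z : B1Eq324BenfattoLemma.Site d → ℝ => (smallFieldOn (frame1 L w m : Set (B1Eq324BenfattoLemma.Site d)) I (γ * b)).indicator (fun _ => (1 : ℝ)) z *
              (smallFieldOn (shrink L m w : Set (B1Eq324BenfattoLemma.Site d)) I b).indicator (fun _ => (1 : ℝ)) z * Real.exp (W m z)) (C := Real.exp KW)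
        (ae_of_all _ fun z => by
          rw [Real.norm_eq_abs]
          exact abs_boxObs_le hJI hγ1 hb0 m (hWb m) z)
      rwa [Real.norm_eq_abs, probReal_univ, mul_one] at h
  have hLi : Integrable (fun ξ : B1Eq324BenfattoLemma.Site d → ℝ => (smallFieldOn (corridors L w B : Set (B1Eq324BenfattoLemma.Site d)) I (γ * b)).indicator (fun _ => (1 : ℝ)) ξ *
          Real.exp (hamiltonian s D κ a (corridors L w B) ξ) *
        ((∫ z, (smallFieldOn (out L B) I b).indicator (fun _ => (1 : ℝ)) z ∂((gaussianFieldOfKernel Kout).map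
              fun (ζ : B1Eq324BenfattoLemma.Site d → ℝ) (x : B1Eq324BenfattoLemma.Site d) => condMean K (C ∪ corridors L w B) ξ x + ζ x)) *
          ∏ m ∈ B, ∫ z, (smallFieldOn (frame1 L w m : Set (B1Eq324BenfattoLemma.Site d)) I (γ * b)).indicator (fun _ => (1 : ℝ)) z *
              (smallFieldOn (shrink L m w : Set (B1Eq324BenfattoLemma.Site d)) I b).indicator (fun _ => (1 : ℝ)) z * Real.exp (W m z) ∂((gaussianFieldOfKernel (Kb m)).map
              fun (ζ : B1Eq324BenfattoLemma.Site d → ℝ) (x : B1Eq324BenfattoLemma.Site d) => condMean K (C ∪ corridors L w B) ξ x + ζ x))) ((gaussianFieldOfKernel (condCov K C)).map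
          fun (ζ : B1Eq324BenfattoLemma.Site d → ℝ) (x : B1Eq324BenfattoLemma.Site d) => condMean K C zbar x + ζ x) :=
    Integrable.of_bound hLm.aestronglyMeasurable _ (ae_of_all _ hLb)
  -- the conditioned integrals are measurable in the datum and bounded
  have hRm := stronglyMeasurable_integral_shift K (C ∪ corridors L w B) (gaussianFieldOfKernel (condCov K (C ∪ corridors L w B))) hΦm
  have hRi : Integrable (fun ξ : B1Eq324BenfattoLemma.Site d → ℝ => ∫ z, (smallFieldOn (corridors L w B : Set (B1Eq324BenfattoLemma.Site d)) I (γ * b)).indicator (fun _ => (1 : ℝ)) z *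
          Real.exp (hamiltonian s D κ a (corridors L w B) z) *
        ((smallFieldOn (out L B) I b).indicator (fun _ => (1 : ℝ)) z *
          ∏ m ∈ B, (smallFieldOn (frame1 L w m : Set (B1Eq324BenfattoLemma.Site d)) I (γ * b)).indicator (fun _ => (1 : ℝ)) z *
              (smallFieldOn (shrink L m w : Set (B1Eq324BenfattoLemma.Site d)) I b).indicator (fun _ => (1 : ℝ)) z * Real.exp (W m z)) ∂((gaussianFieldOfKernel (condCov K (C ∪ corridors L w B))).map
              fun (ζ : B1Eq324BenfattoLemma.Site d → ℝ) (x : B1Eq324BenfattoLemma.Site d) => condMean K (C ∪ corridors L w B) ξ x + ζ x)) ((gaussianFieldOfKernel (condCov K C)).map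
          fun (ζ : B1Eq324BenfattoLemma.Site d → ℝ) (x : B1Eq324BenfattoLemma.Site d) => condMean K C zbar x + ζ x) := by
    refine Integrable.of_bound hRm.aestronglyMeasurable (Real.exp (s1Const s D d κ * Ac * b ^ D * (corridors L w B).card) * (1 * ∏ _m ∈ B, Real.exp KW)) (ae_of_all _ fun ξ => ?_)
    haveI : IsProbabilityMeasure ((gaussianFieldOfKernel (condCov K (C ∪ corridors L w B))).map
              fun (ζ : B1Eq324BenfattoLemma.Site d → ℝ) (x : B1Eq324BenfattoLemma.Site d) => condMean K (C ∪ corridors L w B) ξ x + ζ x) := isProbabilityMeasure_condFieldK hKpsd (C ∪ corridors L w B) hdetS ξ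
    have h := norm_integral_le_of_norm_le_const (μ := ((gaussianFieldOfKernel (condCov K (C ∪ corridors L w B))).map
              fun (ζ : B1Eq324BenfattoLemma.Site d → ℝ) (x : B1Eq324BenfattoLemma.Site d) => condMean K (C ∪ corridors L w B) ξ x + ζ x))
      (ae_of_all _ fun z => show ‖(smallFieldOn (corridors L w B : Set (B1Eq324BenfattoLemma.Site d)) I (γ * b)).indicator (fun _ => (1 : ℝ)) z *
          Real.exp (hamiltonian s D κ a (corridors L w B) z) *
        ((smallFieldOn (out L B) I b).indicator (fun _ => (1 : ℝ)) z *
          ∏ m ∈ B, (smallFieldOn (frame1 L w m : Set (B1Eq324BenfattoLemma.Site d)) I (γ * b)).indicator (fun _ => (1 : ℝ)) z *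
              (smallFieldOn (shrink L m w : Set (B1Eq324BenfattoLemma.Site d)) I b).indicator (fun _ => (1 : ℝ)) z * Real.exp (W m z))‖ ≤ Real.exp (s1Const s D d κ * Ac * b ^ D * (corridors L w B).card) * (1 * ∏ _m ∈ B, Real.exp KW) from by rw [Real.norm_eq_abs]; exact hΦb z)
    rwa [probReal_univ, mul_one] at h
  -- under the outer measure the datum is `z̄` on `C`, so the `C`-cut-off holds a.s.
  have haeC : ∀ᵐ ξ ∂((gaussianFieldOfKernel (condCov K C)).map
          fun (ζ : B1Eq324BenfattoLemma.Site d → ℝ) (x : B1Eq324BenfattoLemma.Site d) => condMean K C zbar x + ζ x), ξ ∈ smallFieldOn (C : Set (B1Eq324BenfattoLemma.Site d)) I b := by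
    filter_upwards [condFieldK_ae_eqOn hKpsd C hdetC zbar] with ξ hξ x hx
    rw [hξ x (Finset.mem_coe.mp hx)]
    exact hzbar x hx
  -- the two-stage tower: conditioning `P̄^K_{C,z̄}` further on `Γ₁ ∖ C` gives `P̄^K_{C ∪ Γ₁,ξ}`
  have hU : C ∪ (corridors L w B \ C) = C ∪ corridors L w B := Finset.union_sdiff_self_eq_union
  have hE : (covGram K (C ∪ (corridors L w B \ C))).PosDef := by
    rw [hU]
    exact posDef_covGram_kernel hK hA hSΛ
  have htower := integral_condFieldK_eq_integral_condFieldK_union hKpsd C (corridors L w B \ C) Finset.sdiff_disjoint hE zbar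
    (g := fun p : (↥(corridors L w B \ C) → ℝ) × (B1Eq324BenfattoLemma.Site d → ℝ) => (smallFieldOn (corridors L w B : Set (B1Eq324BenfattoLemma.Site d)) I (γ * b)).indicator (fun _ => (1 : ℝ)) p.2 *
          Real.exp (hamiltonian s D κ a (corridors L w B) p.2) *
        ((smallFieldOn (out L B) I b).indicator (fun _ => (1 : ℝ)) p.2 *
          ∏ m ∈ B, (smallFieldOn (frame1 L w m : Set (B1Eq324BenfattoLemma.Site d)) I (γ * b)).indicator (fun _ => (1 : ℝ)) p.2 *
              (smallFieldOn (shrink L m w : Set (B1Eq324BenfattoLemma.Site d)) I b).indicator (fun _ => (1 : ℝ)) p.2 * Real.exp (W m p.2)))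
    (hΦm.comp measurable_snd) (M := Real.exp (s1Const s D d κ * Ac * b ^ D * (corridors L w B).card) * (1 * ∏ _m ∈ B, Real.exp KW)) (fun p => hΦb p.2)
  simp only [hU] at htower
  rw [htower, ← integral_const_mul]
  refine ⟨integral_mono_ae (hLi.const_mul _) hRi ?_, ?_⟩
  · filter_upwards [haeC] with ξ hξC
    exact (inner_two_sided hK hAs hγA0 hγA hJI hL hγ1 hb hSΛ hBΛ π hπ r hr hrmax hγr hKb hKout hu hT W hWdep hWm hWb' ξ hξC).2.1
  rw [← integral_const_mul]
  refine integral_mono_ae hRi (hLi.const_mul _) ?_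
  filter_upwards [haeC] with ξ hξC
  exact (inner_two_sided hK hAs hγA0 hγA hJI hL hγ1 hb hSΛ hBΛ π hπ r hr hrmax hγr hKb hKout hu hT W hWdep hWm hWb' ξ hξC).2.2


/-- **(5.36) — (5.13) FOR THE PRODUCT OVER BOXES UNDER THE CONDITIONED CLASS FIELD `P̄^K_{C,z̄}`, lower.**  The class twin of
`…Sect5Eq536.integral_boxes_factorise_eq_cond`: outer measure `P̄^K_{C,z̄}` (`C ∪ Γ₁ ⊆ Λ`, `z̄` small on `C`: `|z̄_Δ| ≤ b(1+d(Δ,I))` — p. 159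
«assuming |z_Δ| ≦ b(1 + d(Δ, I)), ∀Δ ∈ C»), inner conditioning on `S = C ∪ Γ₁` (two-stage law `…KernelCondField.integral_condFieldK_eq_integral_condFieldK_union`),
parts of `Λ ∖ S` = `shrink L m w ∖ C` and the far part, part fields `N^K_{P,ξ} = 𝒩(0,K_P)∘(u_S(ξ)+·)⁻¹`; rows `hπ hr hrmax hγr hKb hKout hT` on `Λ ∖ S`, the centre
row `hu` on the event «`ξ` small on `Γ₁` (γb) and on `C` (b)»:
`e^{−(ρ+T/2)}·∫ χ^{Γ₁}_{γb}(ξ)e^{H_{Γ₁}(ξ)}·[∫χ^{out}_b dN^K_{out,ξ}]·Π_□[∫ χ^{Γ₁(□)}_{γb}χ^□_b e^{W_□} dN^K_{□,ξ}] dP̄^K_{C,z̄}(ξ)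
  ≤ ∫ χ^{Γ₁}_{γb}e^{H_{Γ₁}}·χ^{out}_b·Π_□(χ^{Γ₁(□)}_{γb}χ^□_b e^{W_□}) dP̄^K_{C,z̄}`.  At `C = ∅` this is `…KernelSect5Eq515.integral_boxes_factorise_ge`
(`…KernelCondField.condFieldK_empty`). [cite: BenfattoEtAl1978, §5 (5.13) p.155, (5.36) p.159 (class substitute at temperature zero; ours)] -/
theorem integral_boxes_factorise_cond_ge (hκ : 0 < κ) (hJ : CoefSupportedIn a J) (hAc0 : 0 ≤ Ac)
    (hAc : ∀ p ∈ Finset.Icc 1 s, ∀ (Δ : Fin p → B1Eq324BenfattoLemma.Site d), (∀ i, Δ i ∈ J) →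
      ∀ n ∈ admissible p D, |a p Δ n| ≤ Ac)
    (W : B1Eq324BenfattoLemma.Site d → (B1Eq324BenfattoLemma.Site d → ℝ) → ℝ)
    (hWdep : ∀ m, ∀ z z' : B1Eq324BenfattoLemma.Site d → ℝ, (∀ x ∈ box L m, z x = z' x) → W m z = W m z')
    (hWm : ∀ m, Measurable (W m)) {KW : ℝ}
    (hWb : ∀ m, ∀ z : B1Eq324BenfattoLemma.Site d → ℝ, (∀ x ∈ J, x ∈ box L m → |z x| ≤ b) → |W m z| ≤ KW)
    (zbar : B1Eq324BenfattoLemma.Site d → ℝ) (hzbar : zbar ∈ smallFieldOn (C : Set (B1Eq324BenfattoLemma.Site d)) I b) :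
    Real.exp (-((∑ y, r y) / (γA - rmax) + T / 2)) *
      ∫ ξ, (smallFieldOn (corridors L w B : Set (B1Eq324BenfattoLemma.Site d)) I (γ * b)).indicator (fun _ => (1 : ℝ)) ξ *
          Real.exp (hamiltonian s D κ a (corridors L w B) ξ) *
        ((∫ z, (smallFieldOn (out L B) I b).indicator (fun _ => (1 : ℝ)) z ∂((gaussianFieldOfKernel Kout).map
              fun (ζ : B1Eq324BenfattoLemma.Site d → ℝ) (x : B1Eq324BenfattoLemma.Site d) => condMean K (C ∪ corridors L w B) ξ x + ζ x)) *
          ∏ m ∈ B, ∫ z, (smallFieldOn (frame1 L w m : Set (B1Eq324BenfattoLemma.Site d)) I (γ * b)).indicator (fun _ => (1 : ℝ)) z *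
              (smallFieldOn (shrink L m w : Set (B1Eq324BenfattoLemma.Site d)) I b).indicator (fun _ => (1 : ℝ)) z * Real.exp (W m z) ∂((gaussianFieldOfKernel (Kb m)).map
              fun (ζ : B1Eq324BenfattoLemma.Site d → ℝ) (x : B1Eq324BenfattoLemma.Site d) => condMean K (C ∪ corridors L w B) ξ x + ζ x)) ∂((gaussianFieldOfKernel (condCov K C)).map
          fun (ζ : B1Eq324BenfattoLemma.Site d → ℝ) (x : B1Eq324BenfattoLemma.Site d) => condMean K C zbar x + ζ x) ≤
      ∫ z, (smallFieldOn (corridors L w B : Set (B1Eq324BenfattoLemma.Site d)) I (γ * b)).indicator (fun _ => (1 : ℝ)) z *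
          Real.exp (hamiltonian s D κ a (corridors L w B) z) *
        ((smallFieldOn (out L B) I b).indicator (fun _ => (1 : ℝ)) z *
          ∏ m ∈ B, (smallFieldOn (frame1 L w m : Set (B1Eq324BenfattoLemma.Site d)) I (γ * b)).indicator (fun _ => (1 : ℝ)) z *
              (smallFieldOn (shrink L m w : Set (B1Eq324BenfattoLemma.Site d)) I b).indicator (fun _ => (1 : ℝ)) z * Real.exp (W m z)) ∂((gaussianFieldOfKernel (condCov K C)).map
          fun (ζ : B1Eq324BenfattoLemma.Site d → ℝ) (x : B1Eq324BenfattoLemma.Site d) => condMean K C zbar x + ζ x) :=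
  (integrated_two_sided hK hAs hγA0 hγA hJI hL hγ1 hb hSΛ hBΛ π hπ r hr hrmax hγr hKb hKout hu hT hκ hJ hAc0 hAc W hWdep hWm hWb zbar hzbar).1

/-- **(5.36) under `P̄^K_{C,z̄}`, upper**: with the same data,
`∫ χ^{Γ₁}_{γb}e^{H_{Γ₁}}·χ^{out}_b·Π_□(χ^{Γ₁(□)}_{γb}χ^□_b e^{W_□}) dP̄^K_{C,z̄}
  ≤ e^{ρ+T/2}·∫ χ^{Γ₁}_{γb}(ξ)e^{H_{Γ₁}(ξ)}·[∫χ^{out}_b dN^K_{out,ξ}]·Π_□[∫ χ^{Γ₁(□)}_{γb}χ^□_b e^{W_□} dN^K_{□,ξ}] dP̄^K_{C,z̄}(ξ)` — the structural input of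
the upper bound (4.6) for the class. [cite: BenfattoEtAl1978, §5 (5.36) p.159, (4.6) p.152 (class substitute at temperature zero; ours)] -/
theorem integral_boxes_factorise_cond_le (hκ : 0 < κ) (hJ : CoefSupportedIn a J) (hAc0 : 0 ≤ Ac)
    (hAc : ∀ p ∈ Finset.Icc 1 s, ∀ (Δ : Fin p → B1Eq324BenfattoLemma.Site d), (∀ i, Δ i ∈ J) →
      ∀ n ∈ admissible p D, |a p Δ n| ≤ Ac)
    (W : B1Eq324BenfattoLemma.Site d → (B1Eq324BenfattoLemma.Site d → ℝ) → ℝ)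
    (hWdep : ∀ m, ∀ z z' : B1Eq324BenfattoLemma.Site d → ℝ, (∀ x ∈ box L m, z x = z' x) → W m z = W m z')
    (hWm : ∀ m, Measurable (W m)) {KW : ℝ}
    (hWb : ∀ m, ∀ z : B1Eq324BenfattoLemma.Site d → ℝ, (∀ x ∈ J, x ∈ box L m → |z x| ≤ b) → |W m z| ≤ KW)
    (zbar : B1Eq324BenfattoLemma.Site d → ℝ) (hzbar : zbar ∈ smallFieldOn (C : Set (B1Eq324BenfattoLemma.Site d)) I b) :
    ∫ z, (smallFieldOn (corridors L w B : Set (B1Eq324BenfattoLemma.Site d)) I (γ * b)).indicator (fun _ => (1 : ℝ)) z *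
          Real.exp (hamiltonian s D κ a (corridors L w B) z) *
        ((smallFieldOn (out L B) I b).indicator (fun _ => (1 : ℝ)) z *
          ∏ m ∈ B, (smallFieldOn (frame1 L w m : Set (B1Eq324BenfattoLemma.Site d)) I (γ * b)).indicator (fun _ => (1 : ℝ)) z *
              (smallFieldOn (shrink L m w : Set (B1Eq324BenfattoLemma.Site d)) I b).indicator (fun _ => (1 : ℝ)) z * Real.exp (W m z)) ∂((gaussianFieldOfKernel (condCov K C)).map
          fun (ζ : B1Eq324BenfattoLemma.Site d → ℝ) (x : B1Eq324BenfattoLemma.Site d) => condMean K C zbar x + ζ x) ≤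
      Real.exp ((∑ y, r y) / (γA - rmax) + T / 2) *
      ∫ ξ, (smallFieldOn (corridors L w B : Set (B1Eq324BenfattoLemma.Site d)) I (γ * b)).indicator (fun _ => (1 : ℝ)) ξ *
          Real.exp (hamiltonian s D κ a (corridors L w B) ξ) *
        ((∫ z, (smallFieldOn (out L B) I b).indicator (fun _ => (1 : ℝ)) z ∂((gaussianFieldOfKernel Kout).map
              fun (ζ : B1Eq324BenfattoLemma.Site d → ℝ) (x : B1Eq324BenfattoLemma.Site d) => condMean K (C ∪ corridors L w B) ξ x + ζ x)) *
          ∏ m ∈ B, ∫ z, (smallFieldOn (frame1 L w m : Set (B1Eq324BenfattoLemma.Site d)) I (γ * b)).indicator (fun _ => (1 : ℝ)) z *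
              (smallFieldOn (shrink L m w : Set (B1Eq324BenfattoLemma.Site d)) I b).indicator (fun _ => (1 : ℝ)) z * Real.exp (W m z) ∂((gaussianFieldOfKernel (Kb m)).map
              fun (ζ : B1Eq324BenfattoLemma.Site d → ℝ) (x : B1Eq324BenfattoLemma.Site d) => condMean K (C ∪ corridors L w B) ξ x + ζ x)) ∂((gaussianFieldOfKernel (condCov K C)).map
          fun (ζ : B1Eq324BenfattoLemma.Site d → ℝ) (x : B1Eq324BenfattoLemma.Site d) => condMean K C zbar x + ζ x) :=
  (integrated_two_sided hK hAs hγA0 hγA hJI hL hγ1 hb hSΛ hBΛ π hπ r hr hrmax hγr hKb hKout hu hT hκ hJ hAc0 hAc W hWdep hWm hWb zbar hzbar).2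

end Main

end Literature.MathematicalPhysics.QuantumFieldTheory.Balaban1983to89.B1Eq324BenfattoKernelSect5Eq536

end
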